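import Literature.Analysis.FluidPDE.DuchonRobertSymmTestFieldPairing
import Literature.Analysis.FluidPDE.DuchonRobertSymmTestFieldProofs
import Literature.Analysis.FunctionSpaces.TorusApproximateIdentity
import HarnessLib

/-!
# Duchon–Robert's regularised symmetric test field: removal of the regularisation, proof of (E3)

Analysis/FluidPDE proof file: the discharge `Torus.drTestApprox_limits_holds` of the named step
fact (E3) `Torus.drTestApprox_limits` of `FluidPDE/DuchonRobertSymmTestField` (Duchon–Robert 2000,
proof of Prop. 1, pp. 250–251: the passage from the regularised identity to the identity for
`(u, p)`; Cheskidov–Constantin–Friedlander–Shvydkoy 2008, §3.1: physical-space mollifications of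
the solution as test functions). With `Sₙ = (ρₙ ⊗ kₙ) ⋆` (`Torus.stConv`, `ρₙ = φₙ.normed` even
normalised time bumps with `rOut → 0`, `kₙ = Torus.kernel εₙ`, `εₙ → 0`), `ū = Torus.stBar T u`,
`wₙ = Sₙū` (`Torus.drVelocityApprox`) and `Φₙ = Sₙ[ψ wₙ^K + (ψwₙ) ⋆ K]` (`Torus.drTestApprox`),
for `u ∈ L³((0,T) × T^d)`, `p ∈ L^{3/2}((0,T) × T^d)`, `K` smooth, `ψ` a scalar test function
supported in `(0,T)`:

  `∫₀ᵀ∫ ⟪wₙ, wₙ ⋆ K⟫ ∂ₜψ → ∫₀ᵀ∫ ⟪u, u ⋆ K⟫ ∂ₜψ`,  `∫₀ᵀ∫ ⟪u, (u·∇)Φₙ⟫ → ∫₀ᵀ∫ ⟪u, (u·∇)Φ⟫`,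
  `∫₀ᵀ∫ ⟪u, ΔΦₙ⟫ → ∫₀ᵀ∫ ⟪u, ΔΦ⟫`,  `∫₀ᵀ∫ p div Φₙ → ∫₀ᵀ∫ p div Φ`,  `Φ(t) = ψ u(t)^K + (ψu(t)) ⋆ K`.

## The proof

* **`Lᵖ` tools for the product mollifier** (Evans, App. C.4, Thm. 7, on `ℝ × T^d`): Young's
  contraction `‖SₙF‖_p ≤ ‖F‖_p` (`eLpNorm_stConv_le`: `Sₙ = ρₙ ⋆ₜ (· ⋆ₓ kₙ)`,
  `Torus.stConv_eq_timeConv`, Young in time `FunctionSpaces.eLpNorm_timeConv_le` and in space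
  `eLpNorm_uncurry_sliceConv_le`); the approximate identity `SₙF → F` in `Lᵖ(ℝ × T^d)`
  (`tendsto_eLpNorm_stConv_sub_self`: slice-wise space convergence
  `Torus.tendsto_lintegral_prod_rpow_enorm_convolution_sub_self` plus time convergence
  `FunctionSpaces.tendsto_eLpNorm_timeConv_sub`); hence `SₙHₙ → H` whenever `Hₙ → H` in `Lᵖ`
  (`tendsto_eLpNorm_stConv_sub_of_tendsto`).
* **Derivatives fall on the inner field**: `∂ᵢ(Sₙ G)(t) = Sₙ(∂ᵢG)(t)` and
  `∂ᵢ∂ᵢ(SₙG)(t) = Sₙ(∂ᵢ∂ᵢG)(t)` for `G ∈ L¹` with smooth slices and integrable slice derivatives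
  (`partialDeriv_stConv_slice`, `partialDeriv_partialDeriv_stConv_slice`: the kernel derivative of
  `Torus.partialDeriv_stConv` is moved back by `Torus.convolution_partialDeriv_right`). The slices
  of the inner field `Gⱼ(s) = ψ(s) (wₙⱼ(s) ⋆ K) + (ψ(s)wₙⱼ(s)) ⋆ K` are smooth, with derivatives
  `∂ᵢψ (wₙⱼ ⋆ K) + ψ (wₙⱼ ⋆ ∂ᵢK) + (ψwₙⱼ) ⋆ ∂ᵢK` etc. (`partialDeriv_symmTestField_kernel`,
  `partialDeriv_partialDeriv_symmTestField`), all bounded and supported in `supp_t ψ × T^d`.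
* **`L³` limits**: `wₙⱼ → ūⱼ` in `L³` and `L²` (approximate identity), hence `wₙⱼ ⋆ₓ L → ūⱼ ⋆ₓ L`
  and `(ψwₙⱼ) ⋆ₓ L → (ψūⱼ) ⋆ₓ L` (`tendsto_eLpNorm_sliceConv_sub`) for the kernels
  `L ∈ {K, ∂ᵢK, ∂ᵢ∂ᵢK}`; with bounded coefficients the slice derivatives of `Gⱼ` converge in `L³`,
  and so do their images under `Sₙ`, i.e. `∂ᵢΦₙⱼ`, `ΔΦₙⱼ`, `div Φₙ`, which are paired with the
  fixed factors `ūⱼūᵢ, ūⱼ, p̄ ∈ L^{3/2}` (`tendsto_integral_mul_of_tendsto_eLpNorm_three`); the cubic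
  term `∫ ∂ₜψ wₙⱼ (wₙⱼ ⋆ K)` converges by `L²` convergence of both factors
  (`tendsto_integral_mul_mul_of_tendsto_eLpNorm_two`).
* **Identification** of the limits with the pairings of `Φ(t) = Torus.symmTestField K (ψ t) (u t)`
  at a.e. time (strongly measurable representatives `Uⱼ` of `ūⱼ` with integrable slices,
  `exists_stronglyMeasurable_integrable_slice`; the blocks of the sibling discharge
  `Torus.symmTestField_identity_holds`).

## References

* J. Duchon, R. Robert, *Inertial energy dissipation for weak solutions of incompressible Euler
  and Navier–Stokes equations*, Nonlinearity 13 (2000) 249–255, proof of Prop. 1 (pp. 250–251).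
  [DuchonRobert2000]
* A. Cheskidov, P. Constantin, S. Friedlander, R. Shvydkoy, *Energy conservation and Onsager's
  conjecture for the Euler equations*, Nonlinearity 21 (2008) = arXiv:0704.0759, §3.1 (last
  paragraph: physical-space mollifications as test functions). [CCFS2008]
* L. C. Evans, *Partial Differential Equations*, 2nd ed. (AMS 2010), App. C.4, Thm. 7
  (properties of mollifiers). [Evans2010]

## Mathlib / tree

Mathlib (this pin): convolution, `ContDiffBump.normed`, `eLpNorm` algebra, Hölder
(`MemLp.integrable_mul`), Fubini; no `Lᵖ` approximate identity and no space–time test-field API.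
Tree: `FunctionSpaces/TorusApproximateIdentity` (slice-wise `Lᵖ` convergence on `α × T^d`),
`FunctionSpaces/TimeMollification` (`tendsto_eLpNorm_timeConv_sub`, `eLpNorm_timeConv_le`),
`FunctionSpaces/TorusSpaceTimeConvolution` (`stConv`, `partialDeriv_stConv`,
`convolution_partialDeriv_right`, `stConv_eq_timeConv`), `FluidPDE/OnsagerCCFSTestField`
(`sliceConv`, `stBar`, `tendsto_integral_mul_of_tendsto_eLpNorm_three`),
`FluidPDE/DuchonRobertSymmTestFieldProofs` (`tendsto_eLpNorm_mul_sub_mul`, slice formulas of the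
symmetric field), `FluidPDE/DuchonRobertSymmTestFieldPairing` (`convolution_stConv_apply`,
`integrable_of_bdd_of_time_support`), `FluidPDE/DuchonRobertSymmTestFieldAdmissible`
(`integrable_symmTestField_inner`).
-/

noncomputable section

open MeasureTheory Set Filter Topology Function UnitAddTorus Metric
open scoped ENNReal NNReal Convolution ContDiff InnerProductSpace

namespace Literature.Analysis.FluidPDE.Torus

open Literature.Analysis.FunctionSpaces

variable {d : Type*} [Fintype d] [DecidableEq d]

/-! ## `Lᵖ` tools for the product mollifier `(ρ ⊗ k) ⋆` on `ℝ × T^d` -/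

section LpTools

variable {F G : ℝ × UnitAddTorus d → ℝ} {ρ : ℝ → ℝ} {k : UnitAddTorus d → ℝ}

omit [DecidableEq d] in
/-- The integrand of a space–time mollification of an integrable field is integrable. [folklore] -/
theorem integrable_mul_stKernel (hF : Integrable F ((volume : Measure ℝ).prod volume))
    (hρ : Continuous ρ) (hρc : HasCompactSupport ρ) (hk : Continuous k) (t : ℝ) (x : UnitAddTorus d) :
    Integrable (fun p : ℝ × UnitAddTorus d => F p * (ρ (t - p.1) * k (x - p.2)))
      ((volume : Measure ℝ).prod volume) := by
  obtain ⟨A, hA⟩ := hρ.bounded_above_of_compact_support hρc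
  obtain ⟨B, hB⟩ := FunctionSpaces.Torus.exists_forall_norm_le_of_continuous hk
  refine hF.mul_bdd (c := A * B) ?_ (Eventually.of_forall fun p => ?_)
  · exact ((hρ.comp (continuous_const.sub continuous_fst)).mul
      (hk.comp (continuous_const.sub continuous_snd))).aestronglyMeasurable
  · rw [norm_mul]
    exact mul_le_mul (hA _) (hB _) (norm_nonneg _) ((norm_nonneg _).trans (hA 0))

omit [DecidableEq d] in
/-- Space–time mollification is subtractive in the field. [folklore] -/
theorem stConv_sub (hF : Integrable F ((volume : Measure ℝ).prod volume))
    (hG : Integrable G ((volume : Measure ℝ).prod volume))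
    (hρ : Continuous ρ) (hρc : HasCompactSupport ρ) (hk : Continuous k) (t : ℝ) (x : UnitAddTorus d) :
    FunctionSpaces.Torus.stConv ρ k (fun q => F q - G q) t x =
      FunctionSpaces.Torus.stConv ρ k F t x - FunctionSpaces.Torus.stConv ρ k G t x := by
  simp only [FunctionSpaces.Torus.stConv]
  rw [← integral_sub (integrable_mul_stKernel hF hρ hρc hk t x) (integrable_mul_stKernel hG hρ hρc hk t x)]
  refine integral_congr_ae (Eventually.of_forall fun p => ?_)
  ring

omit [DecidableEq d] in
/-- Space–time mollification only depends on the a.e. class of the field. [folklore] -/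
theorem stConv_congr_ae (h : F =ᵐ[(volume : Measure ℝ).prod volume] G) (ρ : ℝ → ℝ) (k : UnitAddTorus d → ℝ) :
    FunctionSpaces.Torus.stConv ρ k F = FunctionSpaces.Torus.stConv ρ k G := by
  funext t x
  simp only [FunctionSpaces.Torus.stConv]
  refine integral_congr_ae ?_
  filter_upwards [h] with p hp
  rw [hp]

omit [DecidableEq d] in
/-- A space–time mollification by a normalised time bump and the torus mollifier is jointly
continuous. [folklore] -/
theorem continuous_uncurry_stConv_kernel (hF : Integrable F ((volume : Measure ℝ).prod volume))
    (φ : ContDiffBump (0 : ℝ)) {e : ℝ} (he : 0 < e) (he' : e ≤ 1 / 4) :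
    Continuous (uncurry (FunctionSpaces.Torus.stConv (φ.normed volume) (FunctionSpaces.Torus.kernel e) F)) :=
  FunctionSpaces.Torus.continuous_uncurry_of_continuous_stLift
    (FunctionSpaces.Torus.contDiff_top_stLift_stConv hF φ.contDiff_normed φ.hasCompactSupport_normed
      (FunctionSpaces.Torus.isSmooth_kernel he he')).continuous

omit [DecidableEq d] in
/-- **Young's inequality for the product mollifier** (strongly measurable field): for a
normalised time bump `ρ` and a continuous nonnegative unit-mass space kernel `k`,
`‖(ρ ⊗ k) ⋆ F‖_{Lᵖ(ℝ × T^d)} ≤ ‖F‖_{Lᵖ(ℝ × T^d)}`, `1 ≤ p < ∞` (the space–time mollification is the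
time mollification of the slice-wise space mollification, `Torus.stConv_eq_timeConv`; Young in time,
`FunctionSpaces.eLpNorm_timeConv_le`, and in space, `eLpNorm_uncurry_sliceConv_le`). [folklore] -/
theorem eLpNorm_stConv_le_of_stronglyMeasurable (hFm : StronglyMeasurable F)
    (hF : Integrable F ((volume : Measure ℝ).prod volume)) (φ : ContDiffBump (0 : ℝ))
    (hk : Continuous k) (hk0 : ∀ y, 0 ≤ k y) (hk1 : ∫ y, k y = 1) {p : ℝ≥0∞} (hp : 1 ≤ p) (hp' : p ≠ ⊤) :
    eLpNorm (fun z : ℝ × UnitAddTorus d => FunctionSpaces.Torus.stConv (φ.normed volume) k F z.1 z.2) p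
      ((volume : Measure ℝ).prod volume) ≤ eLpNorm F p ((volume : Measure ℝ).prod volume) := by
  have e : (fun z : ℝ × UnitAddTorus d => FunctionSpaces.Torus.stConv (φ.normed volume) k F z.1 z.2) =
      fun z => (φ.normed volume ⋆[ContinuousLinearMap.lsmul ℝ ℝ, volume] fun σ => sliceConv F k σ z.2) z.1 := by
    funext z
    rw [FunctionSpaces.Torus.stConv_eq_timeConv hF φ.continuous_normed φ.hasCompactSupport_normed hk]
    rfl
  rw [e]
  refine (FunctionSpaces.eLpNorm_timeConv_le (μ := (volume : Measure (UnitAddTorus d))) φ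
    (stronglyMeasurable_uncurry_sliceConv hFm hk) hp hp').trans ?_
  refine (eLpNorm_uncurry_sliceConv_le hFm hk hp hp').trans ?_
  rw [FunctionSpaces.Torus.lintegral_enorm_eq_ofReal_integral hk.integrable_unitAddTorus hk0, hk1,
    ENNReal.ofReal_one, one_mul]

omit [DecidableEq d] in
/-- **Young's inequality for the product mollifier**: `‖(ρ ⊗ k) ⋆ F‖_{Lᵖ} ≤ ‖F‖_{Lᵖ}` on `ℝ × T^d`
for an integrable `F`, a normalised time bump and a continuous nonnegative unit-mass space kernel,
`1 ≤ p < ∞`. [folklore] -/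
theorem eLpNorm_stConv_le (hF : Integrable F ((volume : Measure ℝ).prod volume)) (φ : ContDiffBump (0 : ℝ))
    (hk : Continuous k) (hk0 : ∀ y, 0 ≤ k y) (hk1 : ∫ y, k y = 1) {p : ℝ≥0∞} (hp : 1 ≤ p) (hp' : p ≠ ⊤) :
    eLpNorm (fun z : ℝ × UnitAddTorus d => FunctionSpaces.Torus.stConv (φ.normed volume) k F z.1 z.2) p
      ((volume : Measure ℝ).prod volume) ≤ eLpNorm F p ((volume : Measure ℝ).prod volume) := by
  have hae : F =ᵐ[(volume : Measure ℝ).prod volume] hF.1.mk F := hF.1.ae_eq_mk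
  rw [stConv_congr_ae hae, eLpNorm_congr_ae hae]
  exact eLpNorm_stConv_le_of_stronglyMeasurable hF.1.stronglyMeasurable_mk (hF.congr hae) φ hk hk0 hk1 hp hp'

omit [DecidableEq d] in
/-- **Slice-wise space mollification by the torus mollifier converges in `Lᵖ(ℝ × T^d)`**:
`‖F ⋆ₓ k_{εₙ} - F‖_{Lᵖ} → 0` for `F ∈ Lᵖ(ℝ × T^d)`, `1 ≤ p < ∞`, `εₙ → 0`
(`Torus.tendsto_lintegral_prod_rpow_enorm_convolution_sub_self`). [folklore] -/
theorem tendsto_eLpNorm_sliceConv_kernel_sub_self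
    (hFm : AEStronglyMeasurable F ((volume : Measure ℝ).prod volume))
    {p : ℝ≥0∞} (hp : 1 ≤ p) (hp' : p ≠ ⊤) (hFp : eLpNorm F p ((volume : Measure ℝ).prod volume) < ⊤)
    {ε : ℕ → ℝ} (hε : ∀ n, 0 < ε n ∧ ε n ≤ 1 / 4) (hε0 : Tendsto ε atTop (𝓝 0)) :
    Tendsto (fun n => eLpNorm (fun z : ℝ × UnitAddTorus d =>
      sliceConv F (FunctionSpaces.Torus.kernel (ε n)) z.1 z.2 - F z) p ((volume : Measure ℝ).prod volume))
      atTop (𝓝 0) := by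
  have hp0 : p ≠ 0 := (zero_lt_one.trans_le hp).ne'
  have hr : 1 ≤ p.toReal := by
    have h := ENNReal.toReal_mono hp' hp
    rwa [ENNReal.toReal_one] at h
  have hr0 : 0 < p.toReal := one_pos.trans_le hr
  have hk : ∀ᶠ n in atTop, (∀ y, 0 ≤ FunctionSpaces.Torus.kernel (d := d) (ε n) y) ∧
      ∫ y, FunctionSpaces.Torus.kernel (d := d) (ε n) y = 1 ∧ Continuous (FunctionSpaces.Torus.kernel (d := d) (ε n)) :=
    Eventually.of_forall fun n => ⟨fun y => FunctionSpaces.Torus.kernel_nonneg (hε n).1.le y,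
      FunctionSpaces.Torus.integral_kernel (hε n).1 (hε n).2, FunctionSpaces.Torus.continuous_kernel (hε n).1 (hε n).2⟩
  have hsupp : ∀ δ > 0, ∀ᶠ n in atTop, support (FunctionSpaces.Torus.kernel (d := d) (ε n)) ⊆ ball 0 δ := by
    intro δ hδ
    filter_upwards [hε0.eventually (gt_mem_nhds hδ)] with n hn
    exact (FunctionSpaces.Torus.support_kernel_subset (hε n).1).trans (ball_subset_ball hn.le)
  have hm : AEStronglyMeasurable (uncurry fun a x => F (a, x)) ((volume : Measure ℝ).prod volume) := hFm
  have hfin : ∫⁻ z, ‖F (z.1, z.2)‖ₑ ^ p.toReal ∂((volume : Measure ℝ).prod volume) < ⊤ := by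
    have h := lintegral_rpow_enorm_lt_top_of_eLpNorm_lt_top hp0 hp' hFp
    simpa using h
  have h := FunctionSpaces.Torus.tendsto_lintegral_prod_rpow_enorm_convolution_sub_self
    (μ := (volume : Measure ℝ)) hk hsupp hm hr hfin
  have h2 : Tendsto (fun n => (∫⁻ z, ‖((fun x => F (z.1, x)) ⋆ FunctionSpaces.Torus.kernel (ε n)) z.2 - F (z.1, z.2)‖ₑ ^ p.toReal
      ∂((volume : Measure ℝ).prod volume)) ^ (1 / p.toReal)) atTop (𝓝 0) := by
    have h3 := ((ENNReal.continuous_rpow_const (y := 1 / p.toReal)).tendsto 0).comp h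
    rwa [ENNReal.zero_rpow_of_pos (by positivity)] at h3
  refine h2.congr fun n => ?_
  rw [eLpNorm_eq_lintegral_rpow_enorm_toReal hp0 hp']
  rfl

omit [DecidableEq d] in
/-- **The product mollifier is an approximate identity in `Lᵖ(ℝ × T^d)`** (strongly measurable
field): for `F ∈ L¹ ∩ Lᵖ(ℝ × T^d)`, `1 ≤ p < ∞`, normalised time bumps `ρₙ` with `rOut → 0` and
torus mollifiers `k_{εₙ}`, `εₙ → 0`: `‖(ρₙ ⊗ k_{εₙ}) ⋆ F - F‖_{Lᵖ} → 0`. Proof: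
`(ρₙ ⊗ kₙ) ⋆ F - F = ρₙ ⋆ₜ (F ⋆ₓ kₙ - F) + (ρₙ ⋆ₜ F - F)`; Young in time for the first term and the
slice-wise convergence `tendsto_eLpNorm_sliceConv_kernel_sub_self`, the time convergence
`FunctionSpaces.tendsto_eLpNorm_timeConv_sub` for the second. [folklore] -/
theorem tendsto_eLpNorm_stConv_sub_self_of_stronglyMeasurable (hFm : StronglyMeasurable F)
    (hF : Integrable F ((volume : Measure ℝ).prod volume))
    {p : ℝ≥0∞} (hp : 1 ≤ p) (hp' : p ≠ ⊤) (hFp : eLpNorm F p ((volume : Measure ℝ).prod volume) < ⊤)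
    {φ : ℕ → ContDiffBump (0 : ℝ)} (hφ : Tendsto (fun n => (φ n).rOut) atTop (𝓝 0))
    {ε : ℕ → ℝ} (hε : ∀ n, 0 < ε n ∧ ε n ≤ 1 / 4) (hε0 : Tendsto ε atTop (𝓝 0)) :
    Tendsto (fun n => eLpNorm (fun z : ℝ × UnitAddTorus d =>
      FunctionSpaces.Torus.stConv ((φ n).normed volume) (FunctionSpaces.Torus.kernel (ε n)) F z.1 z.2 - F z) p
        ((volume : Measure ℝ).prod volume)) atTop (𝓝 0) := by
  set μ : Measure (ℝ × UnitAddTorus d) := (volume : Measure ℝ).prod volume with hμ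
  have hp0 : p ≠ 0 := (zero_lt_one.trans_le hp).ne'
  have hkc : ∀ n, Continuous (FunctionSpaces.Torus.kernel (d := d) (ε n)) := fun n =>
    FunctionSpaces.Torus.continuous_kernel (hε n).1 (hε n).2
  -- the slice-wise space mollifications and the curried field
  set W : ℕ → ℝ → UnitAddTorus d → ℝ := fun n => sliceConv F (FunctionSpaces.Torus.kernel (ε n)) with hW
  have hWm : ∀ n, StronglyMeasurable (uncurry (W n)) := fun n => stronglyMeasurable_uncurry_sliceConv hFm (hkc n)
  have hWp : ∀ n, eLpNorm (uncurry (W n)) p μ < ⊤ := fun n =>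
    (eLpNorm_uncurry_sliceConv_le hFm (hkc n) hp hp').trans_lt
      (ENNReal.mul_lt_top (hkc n).integrable_unitAddTorus.2 hFp)
  set g : ℝ → UnitAddTorus d → ℝ := fun s x => F (s, x) with hg
  have hgm : StronglyMeasurable (uncurry g) := hFm
  have hgp : eLpNorm (uncurry g) p μ < ⊤ := hFp
  -- the two differences
  set D₁ : ℕ → ℝ × UnitAddTorus d → ℝ := fun n z =>
    ((φ n).normed volume ⋆ fun s => W n s z.2) z.1 - ((φ n).normed volume ⋆ fun s => g s z.2) z.1 with hD₁
  set D₂ : ℕ → ℝ × UnitAddTorus d → ℝ := fun n z =>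
    ((φ n).normed volume ⋆ fun s => g s z.2) z.1 - F z with hD₂
  have hsplit : ∀ n (z : ℝ × UnitAddTorus d),
      FunctionSpaces.Torus.stConv ((φ n).normed volume) (FunctionSpaces.Torus.kernel (ε n)) F z.1 z.2 - F z =
        D₁ n z + D₂ n z := by
    intro n z
    rw [FunctionSpaces.Torus.stConv_eq_timeConv hF (φ n).continuous_normed (φ n).hasCompactSupport_normed (hkc n)]
    exact (sub_add_sub_cancel _ _ _).symm
  have hD₁m : ∀ n, AEStronglyMeasurable (D₁ n) μ := fun n =>
    ((FunctionSpaces.stronglyMeasurable_timeConv (φ n) (hWm n)).sub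
      (FunctionSpaces.stronglyMeasurable_timeConv (φ n) hgm)).aestronglyMeasurable
  have hD₂m : ∀ n, AEStronglyMeasurable (D₂ n) μ := fun n =>
    ((FunctionSpaces.stronglyMeasurable_timeConv (φ n) hgm).sub hFm).aestronglyMeasurable
  -- `‖D₂ n‖ → 0`: time mollification converges
  have hD₂ : Tendsto (fun n => eLpNorm (D₂ n) p μ) atTop (𝓝 0) :=
    FunctionSpaces.tendsto_eLpNorm_timeConv_sub (μ := (volume : Measure (UnitAddTorus d))) hφ hgm hp hp' hgp
  -- `‖D₁ n‖ ≤ ‖W n - F‖`: a.e. `D₁ n` is the time mollification of `W n - F`, then Young in time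
  have hfibF : ∀ᵐ x ∂(volume : Measure (UnitAddTorus d)), LocallyIntegrable (fun s => g s x) volume := by
    filter_upwards [ae_eLpNorm_fibre_lt_top' hgm hp0 hp' hgp] with x hx
    exact MemLp.locallyIntegrable ⟨(hgm.of_uncurry_right).aestronglyMeasurable, hx⟩ hp
  have hfibW : ∀ᵐ x ∂(volume : Measure (UnitAddTorus d)), ∀ n, LocallyIntegrable (fun s => W n s x) volume := by
    rw [ae_all_iff]
    intro n
    filter_upwards [ae_eLpNorm_fibre_lt_top' (hWm n) hp0 hp' (hWp n)] with x hx
    exact MemLp.locallyIntegrable ⟨((hWm n).of_uncurry_right).aestronglyMeasurable, hx⟩ hp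
  have hD₁le : ∀ n, eLpNorm (D₁ n) p μ ≤ eLpNorm (fun z : ℝ × UnitAddTorus d => W n z.1 z.2 - F z) p μ := by
    intro n
    have hae : D₁ n =ᵐ[μ] fun z => ((φ n).normed volume ⋆ fun s => W n s z.2 - g s z.2) z.1 := by
      refine ae_prod_of_ae_fibre ((hfibF.and hfibW).mono fun x hx t => ?_)
      simp only [hD₁]
      rw [timeConv_sub_apply (φ n).continuous_normed (φ n).hasCompactSupport_normed (hx.2 n) hx.1]
    rw [eLpNorm_congr_ae hae]
    have hgm' : StronglyMeasurable (uncurry fun s x => W n s x - g s x) := (hWm n).sub hgm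
    exact FunctionSpaces.eLpNorm_timeConv_le (μ := (volume : Measure (UnitAddTorus d))) (φ n) hgm' hp hp'
  have hWF : Tendsto (fun n => eLpNorm (fun z : ℝ × UnitAddTorus d => W n z.1 z.2 - F z) p μ) atTop (𝓝 0) :=
    tendsto_eLpNorm_sliceConv_kernel_sub_self hFm.aestronglyMeasurable hp hp' hFp hε hε0
  have hD₁ : Tendsto (fun n => eLpNorm (D₁ n) p μ) atTop (𝓝 0) :=
    tendsto_of_tendsto_of_tendsto_of_le_of_le tendsto_const_nhds hWF (fun n => bot_le) hD₁le
  have hsum : Tendsto (fun n => eLpNorm (D₁ n) p μ + eLpNorm (D₂ n) p μ) atTop (𝓝 0) := by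
    simpa using hD₁.add hD₂
  have hmain : Tendsto (fun n => eLpNorm (fun z => D₁ n z + D₂ n z) p μ) atTop (𝓝 0) :=
    tendsto_of_tendsto_of_tendsto_of_le_of_le tendsto_const_nhds hsum (fun n => bot_le) fun n =>
      eLpNorm_add_le (hD₁m n) (hD₂m n) hp
  refine hmain.congr fun n => ?_
  congr 1
  funext z
  exact (hsplit n z).symm

omit [DecidableEq d] in
/-- **The product mollifier is an approximate identity in `Lᵖ(ℝ × T^d)`**: for
`F ∈ L¹ ∩ Lᵖ(ℝ × T^d)`, `1 ≤ p < ∞`, normalised time bumps `ρₙ` with `rOut → 0` and torus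
mollifiers `k_{εₙ}` with `εₙ → 0`, `‖(ρₙ ⊗ k_{εₙ}) ⋆ F - F‖_{Lᵖ(ℝ × T^d)} → 0` (Evans, App. C.4,
Thm. 7 (iv), on `ℝ × T^d`). [folklore] -/
theorem tendsto_eLpNorm_stConv_sub_self (hF : Integrable F ((volume : Measure ℝ).prod volume))
    {p : ℝ≥0∞} (hp : 1 ≤ p) (hp' : p ≠ ⊤) (hFp : eLpNorm F p ((volume : Measure ℝ).prod volume) < ⊤)
    {φ : ℕ → ContDiffBump (0 : ℝ)} (hφ : Tendsto (fun n => (φ n).rOut) atTop (𝓝 0))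
    {ε : ℕ → ℝ} (hε : ∀ n, 0 < ε n ∧ ε n ≤ 1 / 4) (hε0 : Tendsto ε atTop (𝓝 0)) :
    Tendsto (fun n => eLpNorm (fun z : ℝ × UnitAddTorus d =>
      FunctionSpaces.Torus.stConv ((φ n).normed volume) (FunctionSpaces.Torus.kernel (ε n)) F z.1 z.2 - F z) p
        ((volume : Measure ℝ).prod volume)) atTop (𝓝 0) := by
  have hae : F =ᵐ[(volume : Measure ℝ).prod volume] hF.1.mk F := hF.1.ae_eq_mk
  have hFp' : eLpNorm (hF.1.mk F) p ((volume : Measure ℝ).prod volume) < ⊤ := by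
    rwa [← eLpNorm_congr_ae hae]
  have h := tendsto_eLpNorm_stConv_sub_self_of_stronglyMeasurable hF.1.stronglyMeasurable_mk (hF.congr hae)
    hp hp' hFp' hφ hε hε0
  refine h.congr fun n => ?_
  refine eLpNorm_congr_ae ?_
  filter_upwards [hae] with z hz
  rw [stConv_congr_ae hae.symm ((φ n).normed volume) (FunctionSpaces.Torus.kernel (ε n)), ← hz]

omit [DecidableEq d] in
/-- **`Lᵖ` limits pass through the product mollifier**: if `Hₙ → H₀` in `Lᵖ(ℝ × T^d)`
(`Hₙ, H₀ ∈ L¹`, `H₀ ∈ Lᵖ`, `1 ≤ p < ∞`), then `(ρₙ ⊗ k_{εₙ}) ⋆ Hₙ → H₀` in `Lᵖ` along normalised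
time bumps with `rOut → 0` and torus mollifiers with `εₙ → 0`:
`SₙHₙ - H₀ = Sₙ(Hₙ - H₀) + (SₙH₀ - H₀)`, Young and the approximate identity. [folklore] -/
theorem tendsto_eLpNorm_stConv_sub_of_tendsto {H : ℕ → ℝ × UnitAddTorus d → ℝ} {H₀ : ℝ × UnitAddTorus d → ℝ}
    (hH : ∀ n, Integrable (H n) ((volume : Measure ℝ).prod volume))
    (hH₀ : Integrable H₀ ((volume : Measure ℝ).prod volume)) {p : ℝ≥0∞} (hp : 1 ≤ p) (hp' : p ≠ ⊤)
    (hH₀p : eLpNorm H₀ p ((volume : Measure ℝ).prod volume) < ⊤)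
    (hlim : Tendsto (fun n => eLpNorm (fun z => H n z - H₀ z) p ((volume : Measure ℝ).prod volume)) atTop (𝓝 0))
    {φ : ℕ → ContDiffBump (0 : ℝ)} (hφ : Tendsto (fun n => (φ n).rOut) atTop (𝓝 0))
    {ε : ℕ → ℝ} (hε : ∀ n, 0 < ε n ∧ ε n ≤ 1 / 4) (hε0 : Tendsto ε atTop (𝓝 0)) :
    Tendsto (fun n => eLpNorm (fun z : ℝ × UnitAddTorus d =>
      FunctionSpaces.Torus.stConv ((φ n).normed volume) (FunctionSpaces.Torus.kernel (ε n)) (H n) z.1 z.2 - H₀ z) p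
        ((volume : Measure ℝ).prod volume)) atTop (𝓝 0) := by
  set μ : Measure (ℝ × UnitAddTorus d) := (volume : Measure ℝ).prod volume with hμ
  have hkc : ∀ n, Continuous (FunctionSpaces.Torus.kernel (d := d) (ε n)) := fun n =>
    FunctionSpaces.Torus.continuous_kernel (hε n).1 (hε n).2
  set A : ℕ → ℝ × UnitAddTorus d → ℝ := fun n z =>
    FunctionSpaces.Torus.stConv ((φ n).normed volume) (FunctionSpaces.Torus.kernel (ε n)) (fun q => H n q - H₀ q) z.1 z.2
    with hA
  set B : ℕ → ℝ × UnitAddTorus d → ℝ := fun n z =>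
    FunctionSpaces.Torus.stConv ((φ n).normed volume) (FunctionSpaces.Torus.kernel (ε n)) H₀ z.1 z.2 - H₀ z with hB
  have hsplit : ∀ n (z : ℝ × UnitAddTorus d),
      FunctionSpaces.Torus.stConv ((φ n).normed volume) (FunctionSpaces.Torus.kernel (ε n)) (H n) z.1 z.2 - H₀ z =
        A n z + B n z := by
    intro n z
    simp only [hA, hB]
    rw [stConv_sub (hH n) hH₀ (φ n).continuous_normed (φ n).hasCompactSupport_normed (hkc n)]
    ring
  have hdiff : ∀ n, Integrable (fun q => H n q - H₀ q) μ := fun n => (hH n).sub hH₀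
  have hAle : ∀ n, eLpNorm (A n) p μ ≤ eLpNorm (fun z => H n z - H₀ z) p μ := fun n =>
    eLpNorm_stConv_le (hdiff n) (φ n) (hkc n) (fun y => FunctionSpaces.Torus.kernel_nonneg (hε n).1.le y)
      (FunctionSpaces.Torus.integral_kernel (hε n).1 (hε n).2) hp hp'
  have hA0 : Tendsto (fun n => eLpNorm (A n) p μ) atTop (𝓝 0) :=
    tendsto_of_tendsto_of_tendsto_of_le_of_le tendsto_const_nhds hlim (fun n => bot_le) hAle
  have hB0 : Tendsto (fun n => eLpNorm (B n) p μ) atTop (𝓝 0) :=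
    tendsto_eLpNorm_stConv_sub_self hH₀ hp hp' hH₀p hφ hε hε0
  have hAm : ∀ n, AEStronglyMeasurable (A n) μ := fun n =>
    (continuous_uncurry_stConv_kernel (hdiff n) (φ n) (hε n).1 (hε n).2).aestronglyMeasurable
  have hBm : ∀ n, AEStronglyMeasurable (B n) μ := fun n =>
    (continuous_uncurry_stConv_kernel hH₀ (φ n) (hε n).1 (hε n).2).aestronglyMeasurable.sub hH₀.1
  have hsum : Tendsto (fun n => eLpNorm (A n) p μ + eLpNorm (B n) p μ) atTop (𝓝 0) := by
    simpa using hA0.add hB0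
  have hmain : Tendsto (fun n => eLpNorm (fun z => A n z + B n z) p μ) atTop (𝓝 0) :=
    tendsto_of_tendsto_of_tendsto_of_le_of_le tendsto_const_nhds hsum (fun n => bot_le) fun n =>
      eLpNorm_add_le (hAm n) (hBm n) hp
  refine hmain.congr fun n => ?_
  congr 1
  funext z
  exact (hsplit n z).symm

end LpTools

/-! ## Representatives, slice-wise mollification of convergent sequences, pairings -/

section MoreTools

variable {F : ℝ × UnitAddTorus d → ℝ}

omit [DecidableEq d] in
/-- **A strongly measurable representative with integrable slices**: an integrable field on
`ℝ × T^d` agrees a.e. with a strongly measurable field all of whose time slices are integrable on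
`T^d` (Fubini: almost every slice of a representative is integrable; set the others to zero). [folklore] -/
theorem exists_stronglyMeasurable_integrable_slice (hF : Integrable F ((volume : Measure ℝ).prod volume)) :
    ∃ G : ℝ × UnitAddTorus d → ℝ, StronglyMeasurable G ∧ G =ᵐ[(volume : Measure ℝ).prod volume] F ∧
      ∀ s, Integrable (fun z => G (s, z)) volume := by
  set μ : Measure (ℝ × UnitAddTorus d) := (volume : Measure ℝ).prod volume with hμ
  set G₀ : ℝ × UnitAddTorus d → ℝ := hF.1.mk F with hG₀
  have hG₀m : StronglyMeasurable G₀ := hF.1.stronglyMeasurable_mk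
  have hFG₀ : F =ᵐ[μ] G₀ := hF.1.ae_eq_mk
  have hG₀i : Integrable G₀ μ := hF.congr hFG₀
  -- the slice norms
  set N : ℝ → ℝ≥0∞ := fun s => ∫⁻ z, ‖G₀ (s, z)‖ₑ with hN
  have hNm : Measurable N := hG₀m.measurable.enorm.lintegral_prod_right'
  have hNfin : ∀ᵐ s ∂(volume : Measure ℝ), N s < ⊤ := by
    refine ae_lt_top hNm (ne_of_lt ?_)
    have h := hG₀i.2
    rw [hasFiniteIntegral_iff_enorm, lintegral_prod _ hG₀m.measurable.enorm.aemeasurable] at h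
    exact h
  set S : Set ℝ := {s | N s < ⊤} with hS
  have hSm : MeasurableSet S := hNm measurableSet_Iio
  set G : ℝ × UnitAddTorus d → ℝ := (S ×ˢ (univ : Set (UnitAddTorus d))).indicator G₀ with hG
  refine ⟨G, hG₀m.indicator (hSm.prod MeasurableSet.univ), ?_, fun s => ?_⟩
  · have h1 : G =ᵐ[μ] G₀ := by
      refine ae_prod_of_ae_left (ν := (volume : Measure (UnitAddTorus d))) (hNfin.mono fun s hs x => ?_)
      simp only [hG]
      rw [indicator_of_mem (show (s, x) ∈ S ×ˢ (univ : Set (UnitAddTorus d)) from ⟨hs, mem_univ _⟩)]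
    exact h1.trans hFG₀.symm
  · by_cases hs : s ∈ S
    · have e : (fun z => G (s, z)) = fun z => G₀ (s, z) := by
        funext z
        simp only [hG]
        rw [indicator_of_mem (show (s, z) ∈ S ×ˢ (univ : Set (UnitAddTorus d)) from ⟨hs, mem_univ _⟩)]
      rw [e]
      refine ⟨(hG₀m.comp_measurable measurable_prodMk_left).aestronglyMeasurable, ?_⟩
      rw [hasFiniteIntegral_iff_enorm]
      exact hs
    · have e : (fun z => G (s, z)) = fun _ => 0 := by
        funext z
        simp only [hG]
        rw [indicator_of_notMem (show (s, z) ∉ S ×ˢ (univ : Set (UnitAddTorus d)) from fun h => hs h.1)]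
      rw [e]
      exact integrable_const 0

omit [DecidableEq d] in
/-- **Slice-wise mollification of an `Lᵖ`-convergent sequence converges in `Lᵖ`**: if `Aₙ → B`
in `Lᵖ(ℝ × T^d)` (strongly measurable fields with integrable slices) and `K` is continuous, then
`Aₙ ⋆ₓ K → B ⋆ₓ K` in `Lᵖ(ℝ × T^d)` (linearity and the fibrewise Young inequality
`eLpNorm_uncurry_sliceConv_le`). [folklore] -/
theorem tendsto_eLpNorm_sliceConv_sub {A : ℕ → ℝ × UnitAddTorus d → ℝ} {B : ℝ × UnitAddTorus d → ℝ}
    (hAm : ∀ n, StronglyMeasurable (A n)) (hBm : StronglyMeasurable B)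
    (hAs : ∀ n s, Integrable (fun z => A n (s, z)) volume) (hBs : ∀ s, Integrable (fun z => B (s, z)) volume)
    {K : UnitAddTorus d → ℝ} (hK : Continuous K) {p : ℝ≥0∞} (hp : 1 ≤ p) (hp' : p ≠ ⊤)
    (h : Tendsto (fun n => eLpNorm (fun z => A n z - B z) p ((volume : Measure ℝ).prod volume)) atTop (𝓝 0)) :
    Tendsto (fun n => eLpNorm (fun z : ℝ × UnitAddTorus d => sliceConv (A n) K z.1 z.2 - sliceConv B K z.1 z.2) p
      ((volume : Measure ℝ).prod volume)) atTop (𝓝 0) := by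
  set μ : Measure (ℝ × UnitAddTorus d) := (volume : Measure ℝ).prod volume with hμ
  have hlin : ∀ n (z : ℝ × UnitAddTorus d), sliceConv (A n) K z.1 z.2 - sliceConv B K z.1 z.2 =
      sliceConv (fun q => A n q - B q) K z.1 z.2 := by
    intro n z
    simp only [sliceConv]
    have e : (fun w => A n (z.1, w) - B (z.1, w)) = (fun w => A n (z.1, w)) - fun w => B (z.1, w) := rfl
    rw [e, FunctionSpaces.Torus.sub_convolution (hAs n z.1) (hBs z.1) hK, Pi.sub_apply]
  have hb : ∀ n, eLpNorm (fun z : ℝ × UnitAddTorus d => sliceConv (A n) K z.1 z.2 - sliceConv B K z.1 z.2) p μ ≤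
      (∫⁻ y, ‖K y‖ₑ) * eLpNorm (fun z => A n z - B z) p μ := by
    intro n
    have e : (fun z : ℝ × UnitAddTorus d => sliceConv (A n) K z.1 z.2 - sliceConv B K z.1 z.2) =
        uncurry (sliceConv (fun q => A n q - B q) K) := by
      funext z
      exact hlin n z
    rw [e]
    exact eLpNorm_uncurry_sliceConv_le ((hAm n).sub hBm) hK hp hp'
  have h0 := ENNReal.Tendsto.const_mul h (Or.inr hK.integrable_unitAddTorus.2.ne) (a := ∫⁻ y, ‖K y‖ₑ)
  rw [mul_zero] at h0
  exact tendsto_of_tendsto_of_tendsto_of_le_of_le tendsto_const_nhds h0 (fun n => bot_le) hb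

end MoreTools

section Pairing

variable {α : Type*} [MeasurableSpace α] {μ : Measure α}

/-- **Pairings of two `L²`-convergent sequences against a bounded factor**: if `fₙ → f₀` and
`gₙ → g₀` in `L²` and `|a| ≤ C` is measurable, then `∫ a fₙ gₙ → ∫ a f₀ g₀`
(`a fₙ gₙ - a f₀ g₀ = a (fₙ - f₀) gₙ + a f₀ (gₙ - g₀)` and Cauchy–Schwarz,
`enorm_integral_mul_mul_le_two_two`). [folklore] -/
theorem tendsto_integral_mul_mul_of_tendsto_eLpNorm_two {a : α → ℝ} {C : ℝ} (ha : ∀ x, |a x| ≤ C)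
    (ham : AEStronglyMeasurable a μ) {f g : ℕ → α → ℝ} {f₀ g₀ : α → ℝ}
    (hf : ∀ n, MemLp (f n) 2 μ) (hg : ∀ n, MemLp (g n) 2 μ) (hf₀ : MemLp f₀ 2 μ) (hg₀ : MemLp g₀ 2 μ)
    (hfl : Tendsto (fun n => eLpNorm (fun x => f n x - f₀ x) 2 μ) atTop (𝓝 0))
    (hgl : Tendsto (fun n => eLpNorm (fun x => g n x - g₀ x) 2 μ) atTop (𝓝 0)) :
    Tendsto (fun n => ∫ x, a x * f n x * g n x ∂μ) atTop (𝓝 (∫ x, a x * f₀ x * g₀ x ∂μ)) := by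
  -- integrability of the products
  have hI : ∀ {f' g' : α → ℝ}, MemLp f' 2 μ → MemLp g' 2 μ → Integrable (fun x => a x * f' x * g' x) μ := by
    intro f' g' hf' hg'
    have h1 : Integrable (fun x => f' x * g' x) μ := hf'.integrable_mul hg'
    have h2 := h1.bdd_mul (c := C) ham (Eventually.of_forall fun x => by rw [Real.norm_eq_abs]; exact ha x)
    refine h2.congr (Eventually.of_forall fun x => ?_)
    ring
  -- the bound on the difference
  have hkey : ∀ n, ‖(∫ x, a x * f n x * g n x ∂μ) - ∫ x, a x * f₀ x * g₀ x ∂μ‖ₑ ≤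
      ENNReal.ofReal C * eLpNorm (fun x => f n x - f₀ x) 2 μ * eLpNorm (g n) 2 μ +
        ENNReal.ofReal C * eLpNorm f₀ 2 μ * eLpNorm (fun x => g n x - g₀ x) 2 μ := by
    intro n
    have hd1 : Integrable (fun x => a x * (f n x - f₀ x) * g n x) μ := hI ((hf n).sub hf₀) (hg n)
    have hd2 : Integrable (fun x => a x * f₀ x * (g n x - g₀ x)) μ := hI hf₀ ((hg n).sub hg₀)
    have e : (∫ x, a x * f n x * g n x ∂μ) - ∫ x, a x * f₀ x * g₀ x ∂μ =
        (∫ x, a x * (f n x - f₀ x) * g n x ∂μ) + ∫ x, a x * f₀ x * (g n x - g₀ x) ∂μ := by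
      rw [← integral_sub (hI (hf n) (hg n)) (hI hf₀ hg₀), ← integral_add hd1 hd2]
      refine integral_congr_ae (Eventually.of_forall fun x => ?_)
      ring
    rw [e]
    refine (enorm_add_le _ _).trans (add_le_add ?_ ?_)
    · exact enorm_integral_mul_mul_le_two_two ha ((hf n).sub hf₀).1 (hg n).1
    · exact enorm_integral_mul_mul_le_two_two ha hf₀.1 ((hg n).sub hg₀).1
  -- the bound tends to zero
  have hgn : ∀ n, eLpNorm (g n) 2 μ ≤ eLpNorm (fun x => g n x - g₀ x) 2 μ + eLpNorm g₀ 2 μ := by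
    intro n
    have e : g n = (fun x => g n x - g₀ x) + g₀ := by
      funext x; simp
    conv_lhs => rw [e]
    exact eLpNorm_add_le ((hg n).sub hg₀).1 hg₀.1 one_le_two
  have h1 : Tendsto (fun n => ENNReal.ofReal C * eLpNorm (fun x => f n x - f₀ x) 2 μ *
      (eLpNorm (fun x => g n x - g₀ x) 2 μ + eLpNorm g₀ 2 μ)) atTop (𝓝 0) := by
    have ha1 : Tendsto (fun n => ENNReal.ofReal C * eLpNorm (fun x => f n x - f₀ x) 2 μ) atTop (𝓝 0) := by
      have := ENNReal.Tendsto.const_mul hfl (Or.inr ENNReal.ofReal_ne_top) (a := ENNReal.ofReal C)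
      rwa [mul_zero] at this
    have hb1 : Tendsto (fun n => eLpNorm (fun x => g n x - g₀ x) 2 μ + eLpNorm g₀ 2 μ) atTop
        (𝓝 (0 + eLpNorm g₀ 2 μ)) := hgl.add tendsto_const_nhds
    have := ENNReal.Tendsto.mul ha1 (Or.inr (by simpa using hg₀.eLpNorm_ne_top)) hb1 (Or.inr ENNReal.zero_ne_top)
    rwa [zero_mul] at this
  have h2 : Tendsto (fun n => ENNReal.ofReal C * eLpNorm f₀ 2 μ * eLpNorm (fun x => g n x - g₀ x) 2 μ) atTop (𝓝 0) := by
    have := ENNReal.Tendsto.const_mul hgl (Or.inr (ENNReal.mul_ne_top ENNReal.ofReal_ne_top hf₀.eLpNorm_ne_top))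
      (a := ENNReal.ofReal C * eLpNorm f₀ 2 μ)
    rwa [mul_zero] at this
  have hbound : Tendsto (fun n => ENNReal.ofReal C * eLpNorm (fun x => f n x - f₀ x) 2 μ * eLpNorm (g n) 2 μ +
      ENNReal.ofReal C * eLpNorm f₀ 2 μ * eLpNorm (fun x => g n x - g₀ x) 2 μ) atTop (𝓝 0) := by
    have hsum : Tendsto (fun n => ENNReal.ofReal C * eLpNorm (fun x => f n x - f₀ x) 2 μ *
        (eLpNorm (fun x => g n x - g₀ x) 2 μ + eLpNorm g₀ 2 μ) +
        ENNReal.ofReal C * eLpNorm f₀ 2 μ * eLpNorm (fun x => g n x - g₀ x) 2 μ) atTop (𝓝 0) := by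
      simpa using h1.add h2
    refine tendsto_of_tendsto_of_tendsto_of_le_of_le tendsto_const_nhds hsum (fun n => bot_le) fun n => ?_
    gcongr
    exact hgn n
  have hE : Tendsto (fun n => ‖(∫ x, a x * f n x * g n x ∂μ) - ∫ x, a x * f₀ x * g₀ x ∂μ‖ₑ) atTop (𝓝 0) :=
    tendsto_of_tendsto_of_tendsto_of_le_of_le tendsto_const_nhds hbound (fun n => bot_le) hkey
  rw [tendsto_iff_norm_sub_tendsto_zero]
  have h3 := (ENNReal.tendsto_toReal ENNReal.zero_ne_top).comp hE
  rw [ENNReal.toReal_zero] at h3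
  refine h3.congr fun n => ?_
  simp only [Function.comp_apply, toReal_enorm]

end Pairing

/-! ## Space derivatives of a space–time mollification fall on the field -/

section MoveDeriv

variable {G : ℝ × UnitAddTorus d → ℝ} {ρ : ℝ → ℝ} {k : UnitAddTorus d → ℝ}

/-- **The kernel derivative moves onto a field with smooth slices**:
`stConv ρ (∂ᵢk) G = stConv ρ k (∂ᵢG)` (slice-wise integration by parts on `T^d`,
`Torus.convolution_partialDeriv_right`, inside the time mollification `Torus.stConv_eq_timeConv`),
for `G ∈ L¹(ℝ × T^d)` with smooth slices `G(s, ·)` and `∂ᵢG ∈ L¹(ℝ × T^d)`. [folklore] -/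
theorem stConv_partialDeriv_kernel (hG : Integrable G ((volume : Measure ℝ).prod volume))
    (hGs : ∀ s, FunctionSpaces.Torus.IsSmooth fun z => G (s, z)) (i : d)
    (hG' : Integrable (fun q : ℝ × UnitAddTorus d => FunctionSpaces.Torus.partialDeriv i (fun z => G (q.1, z)) q.2)
      ((volume : Measure ℝ).prod volume))
    (hρ : Continuous ρ) (hρc : HasCompactSupport ρ) (hk : FunctionSpaces.Torus.IsSmooth k) (t : ℝ) (x : UnitAddTorus d) :
    FunctionSpaces.Torus.stConv ρ (FunctionSpaces.Torus.partialDeriv i k) G t x =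
      FunctionSpaces.Torus.stConv ρ k
        (fun q : ℝ × UnitAddTorus d => FunctionSpaces.Torus.partialDeriv i (fun z => G (q.1, z)) q.2) t x := by
  rw [FunctionSpaces.Torus.stConv_eq_timeConv hG hρ hρc (hk.partialDeriv i).continuous,
    FunctionSpaces.Torus.stConv_eq_timeConv hG' hρ hρc hk.continuous]
  congr 1
  funext s
  exact FunctionSpaces.Torus.convolution_partialDeriv_right (hGs s) hk i x

/-- **First space derivatives of a space–time mollification of a field with smooth slices**:
`∂ᵢ[(ρ ⊗ k) ⋆ G](t, ·) = (ρ ⊗ k) ⋆ (∂ᵢG) (t, ·)` (`Torus.partialDeriv_stConv` and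
`stConv_partialDeriv_kernel`). [folklore] -/
theorem partialDeriv_stConv_slice (hG : Integrable G ((volume : Measure ℝ).prod volume))
    (hGs : ∀ s, FunctionSpaces.Torus.IsSmooth fun z => G (s, z)) (i : d)
    (hG' : Integrable (fun q : ℝ × UnitAddTorus d => FunctionSpaces.Torus.partialDeriv i (fun z => G (q.1, z)) q.2)
      ((volume : Measure ℝ).prod volume))
    (hρ : ContDiff ℝ 1 ρ) (hρc : HasCompactSupport ρ) (hk : FunctionSpaces.Torus.IsSmooth k) (t : ℝ) (x : UnitAddTorus d) :
    FunctionSpaces.Torus.partialDeriv i (FunctionSpaces.Torus.stConv ρ k G t) x =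
      FunctionSpaces.Torus.stConv ρ k
        (fun q : ℝ × UnitAddTorus d => FunctionSpaces.Torus.partialDeriv i (fun z => G (q.1, z)) q.2) t x := by
  rw [FunctionSpaces.Torus.partialDeriv_stConv hG hρ hρc (hk.isContDiff (by simp)),
    stConv_partialDeriv_kernel hG hGs i hG' hρ.continuous hρc hk]

/-- **Second space derivatives of a space–time mollification of a field with smooth slices**:
`∂ᵢ∂ᵢ[(ρ ⊗ k) ⋆ G](t, ·) = (ρ ⊗ k) ⋆ (∂ᵢ∂ᵢG) (t, ·)`. [folklore] -/
theorem partialDeriv_partialDeriv_stConv_slice (hG : Integrable G ((volume : Measure ℝ).prod volume))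
    (hGs : ∀ s, FunctionSpaces.Torus.IsSmooth fun z => G (s, z)) (i : d)
    (hG' : Integrable (fun q : ℝ × UnitAddTorus d => FunctionSpaces.Torus.partialDeriv i (fun z => G (q.1, z)) q.2)
      ((volume : Measure ℝ).prod volume))
    (hG'' : Integrable (fun q : ℝ × UnitAddTorus d =>
      FunctionSpaces.Torus.partialDeriv i (FunctionSpaces.Torus.partialDeriv i (fun z => G (q.1, z))) q.2)
      ((volume : Measure ℝ).prod volume))
    (hρ : ContDiff ℝ 1 ρ) (hρc : HasCompactSupport ρ) (hk : FunctionSpaces.Torus.IsSmooth k) (t : ℝ) (x : UnitAddTorus d) :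
    FunctionSpaces.Torus.partialDeriv i (FunctionSpaces.Torus.partialDeriv i (FunctionSpaces.Torus.stConv ρ k G t)) x =
      FunctionSpaces.Torus.stConv ρ k (fun q : ℝ × UnitAddTorus d =>
        FunctionSpaces.Torus.partialDeriv i (FunctionSpaces.Torus.partialDeriv i (fun z => G (q.1, z))) q.2) t x := by
  set G' : ℝ × UnitAddTorus d → ℝ := fun q => FunctionSpaces.Torus.partialDeriv i (fun z => G (q.1, z)) q.2 with hG'def
  have h1 : FunctionSpaces.Torus.partialDeriv i (FunctionSpaces.Torus.stConv ρ k G t) = FunctionSpaces.Torus.stConv ρ k G' t :=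
    funext fun y => partialDeriv_stConv_slice hG hGs i hG' hρ hρc hk t y
  have hG's : ∀ s, FunctionSpaces.Torus.IsSmooth fun z => G' (s, z) := fun s => (hGs s).partialDeriv i
  rw [h1]
  exact partialDeriv_stConv_slice hG' hG's i hG'' hρ hρc hk t x

end MoveDeriv

/-! ## The discharge of (E3) -/

section Discharge

/-- **Discharge of (E3) `Torus.drTestApprox_limits`** (Duchon–Robert 2000, proof of Prop. 1,
pp. 250–251: removal of the regularisation in the tested momentum equation; Cheskidov–Constantin–
Friedlander–Shvydkoy 2008, §3.1: mollified solutions as test functions). With `Sₙ = (ρₙ ⊗ kₙ) ⋆`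
(`ρₙ = φₙ.normed`, `kₙ = Torus.kernel εₙ`), `wₙ = Sₙū` and `Φₙ = Sₙ[ψ wₙ^K + (ψwₙ) ⋆ K]`:
the space derivatives of `Φₙ` are `Sₙ` applied to the slice-wise derivatives of the inner field
(`partialDeriv_stConv_slice`: the kernel derivative is moved onto the smooth slices), which are sums
of bounded cut-offs times `wₙ ⋆ₓ ∂^αK`, `(ψwₙ) ⋆ₓ ∂^αK`; since `Sₙ → 1` strongly in `L³(ℝ × T^d)`
with `‖Sₙ‖ ≤ 1` (`tendsto_eLpNorm_stConv_sub_of_tendsto`) and `wₙ → ū` in `L³`, all of them converge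
in `L³` to the corresponding expressions in `ū`, which are paired with `ūⱼūᵢ, ūⱼ, p̄ ∈ L^{3/2}`; the
cubic term `∫∫ ∂ₜψ ⟪wₙ, wₙ ⋆ K⟫` converges by `L²` convergence of both factors. [cite: DuchonRobert2000, proof of Prop. 1 pp. 250–251] -/
theorem drTestApprox_limits_holds : drTestApprox_limits (d := d) := by
  intro T u p hmeas hu3 hpmeas hp K hK hKev ψ hψ φ hφ ε hε hε0
  -- name the kernels
  obtain ⟨ρ, hρdef⟩ : ∃ ρ : ℕ → ℝ → ℝ, ∀ n, (φ n).normed volume = ρ n := ⟨_, fun n => rfl⟩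
  obtain ⟨kn, hkndef⟩ : ∃ kn : ℕ → UnitAddTorus d → ℝ, ∀ n, FunctionSpaces.Torus.kernel (ε n) = kn n :=
    ⟨_, fun n => rfl⟩
  simp only [hρdef, hkndef]
  set μ : Measure (ℝ × UnitAddTorus d) := (volume : Measure ℝ).prod volume with hμ
  have h13 : (1 : ℝ≥0∞) ≤ 3 := by norm_num
  have h3t : (3 : ℝ≥0∞) ≠ ⊤ := ENNReal.ofNat_ne_top
  have h12 : (1 : ℝ≥0∞) ≤ 2 := by norm_num
  have h2t : (2 : ℝ≥0∞) ≠ ⊤ := ENNReal.ofNat_ne_top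
  have hKc : Continuous K := hK.continuous
  have hKi : ∀ i, FunctionSpaces.Torus.IsSmooth (FunctionSpaces.Torus.partialDeriv i K) := fun i => hK.partialDeriv i
  have hKii : ∀ i, FunctionSpaces.Torus.IsSmooth
      (FunctionSpaces.Torus.partialDeriv i (FunctionSpaces.Torus.partialDeriv i K)) := fun i => (hKi i).partialDeriv i
  ------------------------------------------------------------------ kernels
  have hρs : ∀ n, ContDiff ℝ ∞ (ρ n) := fun n => hρdef n ▸ (φ n).contDiff_normed
  have hρc : ∀ n, HasCompactSupport (ρ n) := fun n => hρdef n ▸ (φ n).hasCompactSupport_normed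
  have hρcont : ∀ n, Continuous (ρ n) := fun n => (hρs n).continuous
  have hρ1 : ∀ n, ContDiff ℝ 1 (ρ n) := fun n => (hρs n).of_le (by norm_cast)
  have hks : ∀ n, FunctionSpaces.Torus.IsSmooth (kn n) := fun n =>
    hkndef n ▸ FunctionSpaces.Torus.isSmooth_kernel (hε n).1 (hε n).2
  have hkc : ∀ n, Continuous (kn n) := fun n => (hks n).continuous
  ------------------------------------------------------------------ ψ data
  obtain ⟨⟨hψst, b, hbT, hψb0⟩, a, ha, hψa0⟩ := hψ
  have hψab : ∀ t, (t ≤ a ∨ b ≤ t) → ψ t = 0 := fun t ht => by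
    rcases ht with ht | ht
    · exact hψa0 t ht
    · exact hψb0 t ht
  have hψIcc : ∀ t, t ∉ Icc a b → ψ t = 0 := fun t ht => by
    rw [mem_Icc, not_and_or, not_le, not_le] at ht
    rcases ht with h | h
    · exact hψab t (Or.inl h.le)
    · exact hψab t (Or.inr h.le)
  have hψ' : FunctionSpaces.Torus.IsSpaceTimeTestIoo T ψ := ⟨⟨hψst, b, hbT, hψb0⟩, a, ha, hψa0⟩
  obtain ⟨hψsm, hdtsm, -, -⟩ := hψ'.isSpaceTimeTest.isSmoothSpaceTimeOn_derived
  have hψdi : ∀ i, FunctionSpaces.Torus.IsSmoothSpaceTimeOn univ (fun t => FunctionSpaces.Torus.partialDeriv i (ψ t)) :=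
    fun i => hψsm.partialDeriv uniqueDiffOn_univ i
  have hψdii : ∀ i, FunctionSpaces.Torus.IsSmoothSpaceTimeOn univ
      (fun t => FunctionSpaces.Torus.partialDeriv i (FunctionSpaces.Torus.partialDeriv i (ψ t))) :=
    fun i => (hψdi i).partialDeriv uniqueDiffOn_univ i
  have hψslice : ∀ t, FunctionSpaces.Torus.IsSmooth (ψ t) := fun t => isSmooth_slice_of_contDiff_stLift hψst t
  -- vanishing of the derived fields off `[a, b]`
  have hdt0 : ∀ t, t ∉ Icc a b → FunctionSpaces.Torus.timeDeriv ψ t = 0 := fun t ht => by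
    funext x
    rw [mem_Icc, not_and_or, not_le, not_le] at ht
    rcases ht with h | h
    · exact timeDeriv_eq_zero_of_support hψst hψa0 hψb0 (Or.inl h.le) x
    · exact timeDeriv_eq_zero_of_support hψst hψa0 hψb0 (Or.inr h.le) x
  have hdi0 : ∀ i t, t ∉ Icc a b → (fun t => FunctionSpaces.Torus.partialDeriv i (ψ t)) t = 0 := fun i t ht => by
    funext x
    show FunctionSpaces.Torus.partialDeriv i (ψ t) x = 0
    rw [hψIcc t ht]
    exact partialDeriv_zero_fun i x
  have hdii0 : ∀ i t, t ∉ Icc a b →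
      (fun t => FunctionSpaces.Torus.partialDeriv i (FunctionSpaces.Torus.partialDeriv i (ψ t))) t = 0 := fun i t ht => by
    funext x
    show FunctionSpaces.Torus.partialDeriv i (FunctionSpaces.Torus.partialDeriv i (ψ t)) x = 0
    have h1 : FunctionSpaces.Torus.partialDeriv i (ψ t) = fun _ => 0 := funext fun y => by
      rw [hψIcc t ht]; exact partialDeriv_zero_fun i y
    rw [h1]
    exact partialDeriv_zero_fun i x
  -- global bounds and continuity
  obtain ⟨Cψ, -, hCψ⟩ := exists_forall_norm_le_of_isSmoothSpaceTimeOn hψsm hψIcc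
  obtain ⟨Cψt, -, hCψt⟩ := exists_forall_norm_le_of_isSmoothSpaceTimeOn hdtsm hdt0
  choose Cψi hCψi0 hCψi using fun i => exists_forall_norm_le_of_isSmoothSpaceTimeOn (hψdi i) (hdi0 i)
  choose Cψii hCψii0 hCψii using fun i => exists_forall_norm_le_of_isSmoothSpaceTimeOn (hψdii i) (hdii0 i)
  have hψb : ∀ t x, |ψ t x| ≤ Cψ := fun t x => by rw [← Real.norm_eq_abs]; exact hCψ t x
  have hψtb : ∀ t x, |FunctionSpaces.Torus.timeDeriv ψ t x| ≤ Cψt := fun t x => by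
    rw [← Real.norm_eq_abs]; exact hCψt t x
  have hψib : ∀ i t x, |FunctionSpaces.Torus.partialDeriv i (ψ t) x| ≤ Cψi i := fun i t x => by
    rw [← Real.norm_eq_abs]; exact hCψi i t x
  have hψiib : ∀ i t x, |FunctionSpaces.Torus.partialDeriv i (FunctionSpaces.Torus.partialDeriv i (ψ t)) x| ≤ Cψii i :=
    fun i t x => by rw [← Real.norm_eq_abs]; exact hCψii i t x
  have hψc : Continuous (uncurry ψ) := hψsm.continuous_uncurry
  have hψtc : Continuous (uncurry (FunctionSpaces.Torus.timeDeriv ψ)) := hdtsm.continuous_uncurry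
  have hψic : ∀ i, Continuous (uncurry fun t x => FunctionSpaces.Torus.partialDeriv i (ψ t) x) := fun i =>
    (hψdi i).continuous_uncurry
  have hψiic : ∀ i, Continuous (uncurry fun t x =>
      FunctionSpaces.Torus.partialDeriv i (FunctionSpaces.Torus.partialDeriv i (ψ t)) x) := fun i =>
    (hψdii i).continuous_uncurry
  ------------------------------------------------------------------ velocity and pressure data
  have hm : AEStronglyMeasurable (uncurry u) ((volume.restrict (Ioo 0 T)).prod volume) :=
    aestronglyMeasurable_uncurry_prod hmeas
  have hu2 : ∫⁻ t in Ioo 0 T, ∫⁻ x, ‖u t x‖ₑ ^ 2 < ⊤ :=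
    (lintegral_enorm_sq_le hm).trans_lt (ENNReal.mul_lt_top
      (ENNReal.rpow_lt_top_of_nonneg (by norm_num) ENNReal.ofReal_ne_top)
      (ENNReal.rpow_lt_top_of_nonneg (by norm_num) hu3.ne))
  have hbar1 : Integrable (stBar T u) μ := integrable_stBar hm hu2
  have hbar2 : MemLp (stBar T u) 2 μ := by
    have := memLp_stBar hm two_ne_zero hu2
    simpa using this
  have hbar3 : MemLp (stBar T u) 3 μ := by
    have := memLp_stBar hm (by norm_num : (3 : ℕ) ≠ 0) hu3
    simpa using this
  have hbar32 : MemLp (stBar T u) (3 / 2) μ := by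
    have h : MemLp (uncurry u) 3 ((volume.restrict (Ioo 0 T)).prod volume) := by
      have h3 := hbar3
      rw [stBar, memLp_indicator_iff_restrict (measurableSet_Ioo.prod MeasurableSet.univ),
        ← Measure.restrict_prod_eq_prod_univ] at h3
      exact h3
    have h' : MemLp (uncurry u) (3 / 2) ((volume.restrict (Ioo 0 T)).prod volume) :=
      h.mono_exponent (ENNReal.div_le_of_le_mul (by norm_num))
    rw [stBar, memLp_indicator_iff_restrict (measurableSet_Ioo.prod MeasurableSet.univ),
      ← Measure.restrict_prod_eq_prod_univ]
    exact h'
  have hbarj1 : ∀ j, Integrable (fun q => stBar T u q j) μ := fun j =>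
    (EuclideanSpace.proj (𝕜 := ℝ) j).integrable_comp hbar1
  have hbarj2 : ∀ j, MemLp (fun q => stBar T u q j) 2 μ := fun j => hbar2.eval_piLp j
  -- strongly measurable representatives of the components, with integrable slices
  choose Uc hUm hUc hUsl using fun j => exists_stronglyMeasurable_integrable_slice (hbarj1 j)
  have hU1 : ∀ j, Integrable (Uc j) μ := fun j => (hbarj1 j).congr (hUc j).symm
  have hU3 : ∀ j, MemLp (Uc j) 3 μ := fun j => (hbar3.eval_piLp j).ae_eq (hUc j).symm
  have hU2 : ∀ j, MemLp (Uc j) 2 μ := fun j => (hbar2.eval_piLp j).ae_eq (hUc j).symm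
  have hU32' : ∀ j, MemLp (Uc j) (3 / 2) μ := fun j => (hbar32.eval_piLp j).ae_eq (hUc j).symm
  have hU32 : ∀ j i, MemLp (fun q => Uc j q * Uc i q) (3 / 2) μ := fun j i => by
    haveI := FunctionSpaces.holderTriple_three_three
    exact (hU3 i).mul (hU3 j)
  have hpbar32 : MemLp (stBarScalar T p) (3 / 2) μ := memLp_stBarScalar hpmeas hp
  have hpbar1 : Integrable (stBarScalar T p) μ := by
    have hpm : AEStronglyMeasurable (uncurry p) ((volume.restrict (Ioo 0 T)).prod volume) :=
      aestronglyMeasurable_uncurry_prod hpmeas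
    have h := hpbar32
    rw [stBarScalar, memLp_indicator_iff_restrict (measurableSet_Ioo.prod MeasurableSet.univ),
      ← Measure.restrict_prod_eq_prod_univ] at h
    rw [stBarScalar, integrable_indicator_iff (measurableSet_Ioo.prod MeasurableSet.univ), IntegrableOn,
      ← Measure.restrict_prod_eq_prod_univ]
    haveI : IsFiniteMeasure ((volume.restrict (Ioo (0 : ℝ) T)).prod (volume : Measure (UnitAddTorus d))) :=
      inferInstance
    refine h.integrable ?_
    rw [ENNReal.le_div_iff_mul_le (Or.inl (by norm_num)) (Or.inl (by norm_num))]
    norm_num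
  -- the cut-off components `Ψⱼ = ψ Uⱼ`
  set Ψ : d → ℝ × UnitAddTorus d → ℝ := fun j q => ψ q.1 q.2 * Uc j q with hΨdef
  have hΨm : ∀ j, StronglyMeasurable (Ψ j) := fun j =>
    (hψc.stronglyMeasurable.comp_measurable (measurable_fst.prodMk measurable_snd)).mul (hUm j)
  have hΨ1 : ∀ j, Integrable (Ψ j) μ := fun j => integrable_cutoff_mul (hU1 j) hψc hψb
  have hΨ3 : ∀ j, MemLp (Ψ j) 3 μ := fun j => by
    refine ⟨(hΨm j).aestronglyMeasurable, lt_of_le_of_lt (eLpNorm_le_mul_eLpNorm_of_ae_le_mul (g := Uc j) (c := Cψ)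
      (Eventually.of_forall fun q => ?_) 3) (ENNReal.mul_lt_top ENNReal.ofReal_lt_top (hU3 j).2)⟩
    simp only [hΨdef, norm_mul, Real.norm_eq_abs]
    exact mul_le_mul_of_nonneg_right (hψb _ _) (abs_nonneg _)
  have hΨsl : ∀ j s, Integrable (fun z => Ψ j (s, z)) volume := fun j s =>
    (hUsl j s).bdd_mul (c := Cψ) ((hψslice s).continuous.aestronglyMeasurable)
      (Eventually.of_forall fun z => by rw [Real.norm_eq_abs]; exact hψb s z)
  ------------------------------------------------------------------ the regularised velocities
  set w : ℕ → d → ℝ → UnitAddTorus d → ℝ := fun n j => FunctionSpaces.Torus.stConv (ρ n) (kn n) (Uc j) with hw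
  have hwvel : ∀ n t x j, drVelocityApprox T u (ρ n) (kn n) t x j = w n j t x := by
    intro n t x j
    show FunctionSpaces.Torus.stConv (ρ n) (kn n) (fun q => stBar T u q j) t x = _
    rw [stConv_congr_ae (hUc j).symm (ρ n) (kn n)]
  have hw_s : ∀ n j, ContDiff ℝ ∞ (FunctionSpaces.Torus.stLift (w n j)) := fun n j =>
    FunctionSpaces.Torus.contDiff_top_stLift_stConv (hU1 j) (hρs n) (hρc n) (hks n)
  have hwc : ∀ n j, Continuous (uncurry (w n j)) := fun n j =>
    FunctionSpaces.Torus.continuous_uncurry_of_continuous_stLift (hw_s n j).continuous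
  have hwsl : ∀ n j s, FunctionSpaces.Torus.IsSmooth (w n j s) := fun n j s =>
    isSmooth_slice_of_contDiff_stLift (hw_s n j) s
  have hwb : ∀ n, ∃ C, ∀ j t x, |w n j t x| ≤ C := by
    intro n
    have h : ∀ j, ∃ C, ∀ t x, |w n j t x| ≤ C := fun j =>
      exists_abs_stConv_le (hU1 j) (hρcont n) (hρc n) (hkc n)
    choose C hC using h
    refine ⟨∑ j, |C j|, fun j t x => ((hC j t x).trans (le_abs_self _)).trans ?_⟩
    exact Finset.single_le_sum (f := fun j => |C j|) (fun j _ => abs_nonneg _) (Finset.mem_univ j)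
  choose Cw hCw using hwb
  have hWvec : ∀ n, drVelocityApprox T u (ρ n) (kn n) = vecField (w n) := by
    intro n
    funext t x
    ext j
    rw [hwvel, vecField_apply]
  have hWsm : ∀ n, ContDiff ℝ ∞ (FunctionSpaces.Torus.stLift (drVelocityApprox T u (ρ n) (kn n))) := by
    intro n
    rw [hWvec n, stLift_vecField]
    exact contDiff_piLp' (p := 2) fun j => hw_s n j
  have hWsl : ∀ n s, FunctionSpaces.Torus.IsSmooth (drVelocityApprox T u (ρ n) (kn n) s) := fun n s =>
    isSmooth_slice_of_contDiff_stLift (hWsm n) s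
  have hWint : ∀ n s, Integrable (drVelocityApprox T u (ρ n) (kn n) s) volume := fun n s => (hWsl n s).integrable
  have hWC : ∀ n t x j, |drVelocityApprox T u (ρ n) (kn n) t x j| ≤ Cw n := fun n t x j => by
    rw [hwvel]; exact hCw n j t x
  have hWcont : ∀ n j, Continuous (uncurry fun t x => drVelocityApprox T u (ρ n) (kn n) t x j) := fun n j => by
    have : (uncurry fun t x => drVelocityApprox T u (ρ n) (kn n) t x j) = uncurry (w n j) := by
      funext q; exact hwvel n q.1 q.2 j
    rw [this]; exact hwc n j
  -- mollified regularised velocities are again space–time mollifications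
  have hwL : ∀ n j {L : UnitAddTorus d → ℝ} (_ : FunctionSpaces.Torus.IsSmooth L),
      Continuous (uncurry fun s x => ((w n j s) ⋆ L) x) ∧ ∃ C, ∀ s x, |((w n j s) ⋆ L) x| ≤ C := by
    intro n j L hL
    have e : (uncurry fun s x => ((w n j s) ⋆ L) x) = uncurry (FunctionSpaces.Torus.stConv (ρ n) (kn n ⋆ L) (Uc j)) := by
      funext q
      exact convolution_stConv_apply (hU1 j) (hρcont n) (hρc n) (hkc n) hL.continuous q.1 q.2
    have hkL : FunctionSpaces.Torus.IsSmooth (kn n ⋆ L) := FunctionSpaces.Torus.isSmooth_convolution (hks n).integrable hL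
    refine ⟨?_, ?_⟩
    · rw [e]
      exact FunctionSpaces.Torus.continuous_uncurry_of_continuous_stLift
        (FunctionSpaces.Torus.contDiff_top_stLift_stConv (hU1 j) (hρs n) (hρc n) hkL).continuous
    · obtain ⟨C, hC⟩ := exists_abs_stConv_le (hU1 j) (hρcont n) (hρc n) hkL.continuous
      refine ⟨C, fun s x => ?_⟩
      rw [convolution_stConv_apply (hU1 j) (hρcont n) (hρc n) (hkc n) hL.continuous s x]
      exact hC s x
  -- the cut-off regularised velocities mollified in space
  have hΨwL : ∀ n j {L : UnitAddTorus d → ℝ} (_ : FunctionSpaces.Torus.IsSmooth L),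
      AEStronglyMeasurable (fun q : ℝ × UnitAddTorus d => ((fun z => ψ q.1 z * w n j q.1 z) ⋆ L) q.2) μ ∧
        ∃ C, ∀ s x, |((fun z => ψ s z * w n j s z) ⋆ L) x| ≤ C := by
    intro n j L hL
    obtain ⟨hb, hmeasL⟩ := bound_and_measurable_sliceConv (w := fun t x => ψ t x * w n j t x) (C := Cψ * Cw n)
      (fun t x => by
        rw [abs_mul]
        exact mul_le_mul (hψb t x) (hCw n j t x) (abs_nonneg _) ((abs_nonneg _).trans (hψb t x)))
      (hψc.mul (hwc n j)) hL.continuous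
    exact ⟨hmeasL, _, hb⟩
  ------------------------------------------------------------------ `L³` and `L²` limits of the pieces
  have hwconv : ∀ j {r : ℝ≥0∞} (_ : 1 ≤ r) (_ : r ≠ ⊤) (_ : MemLp (Uc j) r μ),
      Tendsto (fun n => eLpNorm (fun q : ℝ × UnitAddTorus d => w n j q.1 q.2 - Uc j q) r μ) atTop (𝓝 0) := by
    intro j r hr hr' hUr
    have h := tendsto_eLpNorm_stConv_sub_self (hU1 j) hr hr' hUr.2 hφ hε hε0
    simp only [hρdef, hkndef] at h
    exact h
  have hvconv : ∀ j {L : UnitAddTorus d → ℝ} (_ : FunctionSpaces.Torus.IsSmooth L) {r : ℝ≥0∞} (_ : 1 ≤ r) (_ : r ≠ ⊤)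
      (_ : MemLp (Uc j) r μ),
      Tendsto (fun n => eLpNorm (fun q : ℝ × UnitAddTorus d =>
        ((w n j q.1) ⋆ L) q.2 - sliceConv (Uc j) L q.1 q.2) r μ) atTop (𝓝 0) := by
    intro j L hL r hr hr' hUr
    have h := tendsto_eLpNorm_sliceConv_sub (A := fun n => uncurry (w n j)) (B := Uc j)
      (fun n => (hwc n j).stronglyMeasurable) (hUm j)
      (fun n s => ((hwsl n j s).continuous).integrable_unitAddTorus) (hUsl j) hL.continuous hr hr'
      (hwconv j hr hr' hUr)
    exact h
  have hΨwconv : ∀ j {L : UnitAddTorus d → ℝ} (_ : FunctionSpaces.Torus.IsSmooth L),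
      Tendsto (fun n => eLpNorm (fun q : ℝ × UnitAddTorus d =>
        ((fun z => ψ q.1 z * w n j q.1 z) ⋆ L) q.2 - sliceConv (Ψ j) L q.1 q.2) 3 μ) atTop (𝓝 0) := by
    intro j L hL
    have hcψ : ∀ q : ℝ × UnitAddTorus d, |ψ q.1 q.2| ≤ Cψ := fun q => hψb q.1 q.2
    have h1 : Tendsto (fun n => eLpNorm (fun q : ℝ × UnitAddTorus d =>
        ψ q.1 q.2 * w n j q.1 q.2 - ψ q.1 q.2 * Uc j q) 3 μ) atTop (𝓝 0) :=
      tendsto_eLpNorm_mul_sub_mul hcψ (hwconv j h13 h3t (hU3 j))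
    have h := tendsto_eLpNorm_sliceConv_sub (A := fun n q => ψ q.1 q.2 * w n j q.1 q.2) (B := Ψ j)
      (fun n => (hψc.mul (hwc n j)).stronglyMeasurable) (hΨm j)
      (fun n s => (((hψslice s).continuous.mul (hwsl n j s).continuous)).integrable_unitAddTorus) (hΨsl j)
      hL.continuous h13 h3t h1
    exact h
  ------------------------------------------------------------------ coefficient fields on `ℝ × T^d`
  have hcψ : ∀ q : ℝ × UnitAddTorus d, |ψ q.1 q.2| ≤ Cψ := fun q => hψb q.1 q.2
  have hcψt : ∀ q : ℝ × UnitAddTorus d, |FunctionSpaces.Torus.timeDeriv ψ q.1 q.2| ≤ Cψt := fun q => hψtb q.1 q.2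
  have hcψi : ∀ i (q : ℝ × UnitAddTorus d), |FunctionSpaces.Torus.partialDeriv i (ψ q.1) q.2| ≤ Cψi i :=
    fun i q => hψib i q.1 q.2
  have hcψii : ∀ i (q : ℝ × UnitAddTorus d),
      |FunctionSpaces.Torus.partialDeriv i (FunctionSpaces.Torus.partialDeriv i (ψ q.1)) q.2| ≤ Cψii i :=
    fun i q => hψiib i q.1 q.2
  have hcψc : Continuous fun q : ℝ × UnitAddTorus d => ψ q.1 q.2 := hψc
  have hcψtc : Continuous fun q : ℝ × UnitAddTorus d => FunctionSpaces.Torus.timeDeriv ψ q.1 q.2 := hψtc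
  have hcψic : ∀ i, Continuous fun q : ℝ × UnitAddTorus d => FunctionSpaces.Torus.partialDeriv i (ψ q.1) q.2 := hψic
  have hcψiic : ∀ i, Continuous fun q : ℝ × UnitAddTorus d =>
      FunctionSpaces.Torus.partialDeriv i (FunctionSpaces.Torus.partialDeriv i (ψ q.1)) q.2 := hψiic
  have hcψ0 : ∀ q : ℝ × UnitAddTorus d, q.1 ∉ Icc a b → ψ q.1 q.2 = 0 := fun q hq => by
    rw [hψIcc q.1 hq]; rfl
  have hcψi0 : ∀ i (q : ℝ × UnitAddTorus d), q.1 ∉ Icc a b → FunctionSpaces.Torus.partialDeriv i (ψ q.1) q.2 = 0 :=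
    fun i q hq => by
    have h := congrFun (hdi0 i q.1 hq) q.2
    simpa using h
  have hcψii0 : ∀ i (q : ℝ × UnitAddTorus d), q.1 ∉ Icc a b →
      FunctionSpaces.Torus.partialDeriv i (FunctionSpaces.Torus.partialDeriv i (ψ q.1)) q.2 = 0 := fun i q hq => by
    have h := congrFun (hdii0 i q.1 hq) q.2
    simpa using h
  ------------------------------------------------------------------ generic integrability / membership facts
  have hmem : ∀ {F : ℝ × UnitAddTorus d → ℝ} (_ : StronglyMeasurable F) {r : ℝ≥0∞} (_ : 1 ≤ r) (_ : r ≠ ⊤) (_ : MemLp F r μ)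
      {k : UnitAddTorus d → ℝ} (_ : Continuous k), MemLp (fun q : ℝ × UnitAddTorus d => sliceConv F k q.1 q.2) r μ :=
    fun hFm r hr hr' hF3 k hk => ⟨(stronglyMeasurable_uncurry_sliceConv hFm hk).aestronglyMeasurable,
      (eLpNorm_uncurry_sliceConv_le hFm hk hr hr').trans_lt (ENNReal.mul_lt_top hk.integrable_unitAddTorus.2 hF3.2)⟩
  have hmem_mul : ∀ {c : ℝ × UnitAddTorus d → ℝ} {C : ℝ} (_ : Continuous c) (_ : ∀ q, |c q| ≤ C)
      {g : ℝ × UnitAddTorus d → ℝ} {r : ℝ≥0∞} (_ : MemLp g r μ), MemLp (fun q => c q * g q) r μ :=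
    fun hcc hcb g r hg => hg.of_le_mul (hcc.aestronglyMeasurable.mul hg.1) (Eventually.of_forall fun q => by
      rw [norm_mul, Real.norm_eq_abs]; exact mul_le_mul_of_nonneg_right (hcb q) (norm_nonneg _))
  have hint : ∀ {F : ℝ × UnitAddTorus d → ℝ} (_ : StronglyMeasurable F) (_ : Integrable F μ)
      {k : UnitAddTorus d → ℝ} (_ : Continuous k), Integrable (fun q : ℝ × UnitAddTorus d => sliceConv F k q.1 q.2) μ :=
    fun hFm hF k hk => integrable_uncurry_sliceConv hFm hF hk
  have hint_mul : ∀ {c : ℝ × UnitAddTorus d → ℝ} {C : ℝ} (_ : Continuous c) (_ : ∀ q, |c q| ≤ C)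
      {g : ℝ × UnitAddTorus d → ℝ} (_ : Integrable g μ), Integrable (fun q => c q * g q) μ :=
    fun hcc hcb g hg => hg.bdd_mul hcc.aestronglyMeasurable (Eventually.of_forall fun q => by
      rw [Real.norm_eq_abs]; exact hcb q)
  -- the mollified pieces: integrability and measurability
  have hIpiece : ∀ {c : ℝ × UnitAddTorus d → ℝ} {C : ℝ} (_ : Continuous c) (_ : ∀ q, |c q| ≤ C)
      (_ : ∀ q : ℝ × UnitAddTorus d, q.1 ∉ Icc a b → c q = 0) (n : ℕ) (j : d) {L : UnitAddTorus d → ℝ}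
      (_ : FunctionSpaces.Torus.IsSmooth L),
      Integrable (fun q : ℝ × UnitAddTorus d => c q * ((w n j q.1) ⋆ L) q.2) μ := by
    intro c C hcc hcb hc0 n j L hL
    obtain ⟨hcont, M, hM⟩ := hwL n j hL
    refine integrable_of_bdd_of_time_support (hcc.aestronglyMeasurable.mul hcont.aestronglyMeasurable) (M := C * M)
      (fun q => ?_) (a := a) (b := b) (fun q hq => ?_)
    · rw [Real.norm_eq_abs, abs_mul]
      exact mul_le_mul (hcb q) (hM q.1 q.2) (abs_nonneg _) ((abs_nonneg _).trans (hcb q))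
    · show c q * ((w n j q.1) ⋆ L) q.2 = 0
      rw [hc0 q hq, zero_mul]
  have hIpieceΨ : ∀ (n : ℕ) (j : d) {L : UnitAddTorus d → ℝ} (_ : FunctionSpaces.Torus.IsSmooth L),
      Integrable (fun q : ℝ × UnitAddTorus d => ((fun z => ψ q.1 z * w n j q.1 z) ⋆ L) q.2) μ := by
    intro n j L hL
    obtain ⟨hmeasL, M, hM⟩ := hΨwL n j hL
    refine integrable_of_bdd_of_time_support hmeasL (M := M) (fun q => ?_) (a := a) (b := b) (fun q hq => ?_)
    · rw [Real.norm_eq_abs]; exact hM q.1 q.2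
    · have e : (fun z => ψ q.1 z * w n j q.1 z) = 0 := by
        funext z; rw [hψIcc q.1 hq]; simp
      show ((fun z => ψ q.1 z * w n j q.1 z) ⋆ L) q.2 = 0
      rw [e, zero_convolution]; rfl
  have hMpiece : ∀ {c : ℝ × UnitAddTorus d → ℝ} (_ : Continuous c) (n : ℕ) (j : d) {L : UnitAddTorus d → ℝ}
      (_ : FunctionSpaces.Torus.IsSmooth L),
      AEStronglyMeasurable (fun q : ℝ × UnitAddTorus d => c q * ((w n j q.1) ⋆ L) q.2) μ := fun hcc n j L hL =>
    hcc.aestronglyMeasurable.mul (hwL n j hL).1.aestronglyMeasurable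
  have hMpieceΨ : ∀ (n : ℕ) (j : d) {L : UnitAddTorus d → ℝ} (_ : FunctionSpaces.Torus.IsSmooth L),
      AEStronglyMeasurable (fun q : ℝ × UnitAddTorus d => ((fun z => ψ q.1 z * w n j q.1 z) ⋆ L) q.2) μ :=
    fun n j L hL => (hΨwL n j hL).1
  -- the limit pieces
  have hMlim : ∀ {c : ℝ × UnitAddTorus d → ℝ} (_ : Continuous c) (j : d) {L : UnitAddTorus d → ℝ} (_ : Continuous L),
      AEStronglyMeasurable (fun q : ℝ × UnitAddTorus d => c q * sliceConv (Uc j) L q.1 q.2) μ := fun hcc j L hL =>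
    hcc.aestronglyMeasurable.mul (stronglyMeasurable_uncurry_sliceConv (hUm j) hL).aestronglyMeasurable
  have hMlimΨ : ∀ (j : d) {L : UnitAddTorus d → ℝ} (_ : Continuous L),
      AEStronglyMeasurable (fun q : ℝ × UnitAddTorus d => sliceConv (Ψ j) L q.1 q.2) μ := fun j L hL =>
    (stronglyMeasurable_uncurry_sliceConv (hΨm j) hL).aestronglyMeasurable
  -- convergence of a piece with a bounded continuous coefficient
  have hPconv : ∀ {c : ℝ × UnitAddTorus d → ℝ} {C : ℝ} (_ : ∀ q, |c q| ≤ C) (j : d) {L : UnitAddTorus d → ℝ}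
      (_ : FunctionSpaces.Torus.IsSmooth L),
      Tendsto (fun n => eLpNorm (fun q : ℝ × UnitAddTorus d =>
        c q * ((w n j q.1) ⋆ L) q.2 - c q * sliceConv (Uc j) L q.1 q.2) 3 μ) atTop (𝓝 0) :=
    fun hcb j L hL => tendsto_eLpNorm_mul_sub_mul hcb (hvconv j hL h13 h3t (hU3 j))
  ------------------------------------------------------------------ the inner fields and the test fields
  set G : ℕ → d → ℝ × UnitAddTorus d → ℝ := fun n j q =>
    symmTestField K (ψ q.1) (drVelocityApprox T u (ρ n) (kn n) q.1) q.2 j with hG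
  have hΦdef : ∀ n, drTestApprox T u (ρ n) (kn n) K ψ =
      vecField fun j => FunctionSpaces.Torus.stConv (ρ n) (kn n) (G n j) := fun n => rfl
  have hGi : ∀ n j, Integrable (G n j) μ := fun n j =>
    integrable_symmTestField_inner (hWC n) (hWcont n) hKc hψc hψb hψIcc j
  have hGs : ∀ n j s, FunctionSpaces.Torus.IsSmooth fun z => G n j (s, z) := fun n j s =>
    (EuclideanSpace.proj (𝕜 := ℝ) j).contDiff.comp (isSmooth_symmTestField hK (hψslice s) (hWint n s))
  set φc : ℕ → d → ℝ → UnitAddTorus d → ℝ := fun n j => FunctionSpaces.Torus.stConv (ρ n) (kn n) (G n j) with hφcdef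
  have hφs : ∀ n j, ContDiff ℝ ∞ (FunctionSpaces.Torus.stLift (φc n j)) := fun n j =>
    FunctionSpaces.Torus.contDiff_top_stLift_stConv (hGi n j) (hρs n) (hρc n) (hks n)
  have hφsl : ∀ n j t, FunctionSpaces.Torus.IsSmooth (φc n j t) := fun n j t =>
    isSmooth_slice_of_contDiff_stLift (hφs n j) t
  have hΦvec : ∀ n, drTestApprox T u (ρ n) (kn n) K ψ = vecField (φc n) := fun n => rfl
  -- slice derivatives of the inner fields
  have hdG : ∀ n j i (q : ℝ × UnitAddTorus d), FunctionSpaces.Torus.partialDeriv i (fun z => G n j (q.1, z)) q.2 =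
      FunctionSpaces.Torus.partialDeriv i (ψ q.1) q.2 * ((w n j q.1) ⋆ K) q.2 +
        ψ q.1 q.2 * ((w n j q.1) ⋆ FunctionSpaces.Torus.partialDeriv i K) q.2 +
        ((fun z => ψ q.1 z * w n j q.1 z) ⋆ FunctionSpaces.Torus.partialDeriv i K) q.2 := by
    intro n j i q
    have h := partialDeriv_symmTestField_kernel hK (hψslice q.1) (hWint n q.1) i j q.2
    have e1 : (fun z => drVelocityApprox T u (ρ n) (kn n) q.1 z j) = w n j q.1 := funext fun z => hwvel n q.1 z j
    have e2 : (fun z => ψ q.1 z * drVelocityApprox T u (ρ n) (kn n) q.1 z j) = fun z => ψ q.1 z * w n j q.1 z :=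
      funext fun z => by rw [hwvel]
    rw [e1, e2] at h
    exact h
  have hddG : ∀ n j i (q : ℝ × UnitAddTorus d),
      FunctionSpaces.Torus.partialDeriv i (FunctionSpaces.Torus.partialDeriv i (fun z => G n j (q.1, z))) q.2 =
      FunctionSpaces.Torus.partialDeriv i (FunctionSpaces.Torus.partialDeriv i (ψ q.1)) q.2 * ((w n j q.1) ⋆ K) q.2 +
        2 * (FunctionSpaces.Torus.partialDeriv i (ψ q.1) q.2 * ((w n j q.1) ⋆ FunctionSpaces.Torus.partialDeriv i K) q.2) +
        ψ q.1 q.2 * ((w n j q.1) ⋆ FunctionSpaces.Torus.partialDeriv i (FunctionSpaces.Torus.partialDeriv i K)) q.2 +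
        ((fun z => ψ q.1 z * w n j q.1 z) ⋆
          FunctionSpaces.Torus.partialDeriv i (FunctionSpaces.Torus.partialDeriv i K)) q.2 := by
    intro n j i q
    have h := partialDeriv_partialDeriv_symmTestField hK (hψslice q.1) (hWint n q.1) i j q.2
    have e1 : (fun z => drVelocityApprox T u (ρ n) (kn n) q.1 z j) = w n j q.1 := funext fun z => hwvel n q.1 z j
    have e2 : (fun z => ψ q.1 z * drVelocityApprox T u (ρ n) (kn n) q.1 z j) = fun z => ψ q.1 z * w n j q.1 z :=
      funext fun z => by rw [hwvel]
    rw [e1, e2] at h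
    exact h
  ---------------------------------------------------------------- first derivatives: the fields `g2`
  set g2 : ℕ → d → d → ℝ × UnitAddTorus d → ℝ := fun n j i q =>
    FunctionSpaces.Torus.partialDeriv i (ψ q.1) q.2 * ((w n j q.1) ⋆ K) q.2 +
      ψ q.1 q.2 * ((w n j q.1) ⋆ FunctionSpaces.Torus.partialDeriv i K) q.2 +
      ((fun z => ψ q.1 z * w n j q.1 z) ⋆ FunctionSpaces.Torus.partialDeriv i K) q.2 with hg2
  set g2i : d → d → ℝ × UnitAddTorus d → ℝ := fun j i q =>
    FunctionSpaces.Torus.partialDeriv i (ψ q.1) q.2 * sliceConv (Uc j) K q.1 q.2 +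
      ψ q.1 q.2 * sliceConv (Uc j) (FunctionSpaces.Torus.partialDeriv i K) q.1 q.2 +
      sliceConv (Ψ j) (FunctionSpaces.Torus.partialDeriv i K) q.1 q.2 with hg2i
  have hg2I : ∀ n j i, Integrable (g2 n j i) μ := fun n j i =>
    ((hIpiece (hcψic i) (hcψi i) (hcψi0 i) n j hK).add (hIpiece hcψc hcψ hcψ0 n j (hKi i))).add (hIpieceΨ n j (hKi i))
  have hg2m : ∀ n j i, AEStronglyMeasurable (g2 n j i) μ := fun n j i => (hg2I n j i).1
  have hg2iI : ∀ j i, Integrable (g2i j i) μ := fun j i =>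
    ((hint_mul (hcψic i) (hcψi i) (hint (hUm j) (hU1 j) hKc)).add
      (hint_mul hcψc hcψ (hint (hUm j) (hU1 j) (hKi i).continuous))).add (hint (hΨm j) (hΨ1 j) (hKi i).continuous)
  have hg2im : ∀ j i, MemLp (g2i j i) 3 μ := fun j i =>
    ((hmem_mul (hcψic i) (hcψi i) (hmem (hUm j) h13 h3t (hU3 j) hKc)).add
      (hmem_mul hcψc hcψ (hmem (hUm j) h13 h3t (hU3 j) (hKi i).continuous))).add
      (hmem (hΨm j) h13 h3t (hΨ3 j) (hKi i).continuous)
  have hg2conv : ∀ j i, Tendsto (fun n => eLpNorm (fun q => g2 n j i q - g2i j i q) 3 μ) atTop (𝓝 0) := by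
    intro j i
    refine tendsto_eLpNorm_add_sub_add h13 (Eventually.of_forall fun n => ?_) (Eventually.of_forall fun n => ?_)
      (tendsto_eLpNorm_add_sub_add h13 (Eventually.of_forall fun n => ?_) (Eventually.of_forall fun n => ?_)
        (hPconv (hcψi i) j hK) (hPconv hcψ j (hKi i)))
      (hΨwconv j (hKi i))
    · exact ((hMpiece (hcψic i) n j hK).add (hMpiece hcψc n j (hKi i))).sub
        ((hMlim (hcψic i) j hKc).add (hMlim hcψc j (hKi i).continuous))
    · exact (hMpieceΨ n j (hKi i)).sub (hMlimΨ j (hKi i).continuous)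
    · exact (hMpiece (hcψic i) n j hK).sub (hMlim (hcψic i) j hKc)
    · exact (hMpiece hcψc n j (hKi i)).sub (hMlim hcψc j (hKi i).continuous)
  -- the first derivatives of the test components are `Sₙ g2`
  have hG' : ∀ n j i, Integrable (fun q : ℝ × UnitAddTorus d =>
      FunctionSpaces.Torus.partialDeriv i (fun z => G n j (q.1, z)) q.2) μ := fun n j i =>
    (hg2I n j i).congr (Eventually.of_forall fun q => (hdG n j i q).symm)
  have hdx : ∀ n j i t x, FunctionSpaces.Torus.partialDeriv i (φc n j t) x =
      FunctionSpaces.Torus.stConv (ρ n) (kn n) (g2 n j i) t x := by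
    intro n j i t x
    have e : (fun q : ℝ × UnitAddTorus d => FunctionSpaces.Torus.partialDeriv i (fun z => G n j (q.1, z)) q.2) = g2 n j i :=
      funext (hdG n j i)
    rw [← e]
    exact partialDeriv_stConv_slice (hGi n j) (hGs n j) i (hG' n j i) (hρ1 n) (hρc n) (hks n) t x
  set D : ℕ → d → d → ℝ × UnitAddTorus d → ℝ := fun n j i q =>
    FunctionSpaces.Torus.stConv (ρ n) (kn n) (g2 n j i) q.1 q.2 with hD
  have hDc : ∀ n j i, Continuous (D n j i) := fun n j i =>
    FunctionSpaces.Torus.continuous_uncurry_of_continuous_stLift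
      (FunctionSpaces.Torus.contDiff_top_stLift_stConv (hg2I n j i) (hρs n) (hρc n) (hks n)).continuous
  have hDm : ∀ n j i, AEStronglyMeasurable (D n j i) μ := fun n j i => (hDc n j i).aestronglyMeasurable
  have hDb : ∀ n j i, ∃ C, ∀ q, |D n j i q| ≤ C := fun n j i => by
    obtain ⟨C, hC⟩ := exists_abs_stConv_le (hg2I n j i) (hρcont n) (hρc n) (hkc n)
    exact ⟨C, fun q => hC q.1 q.2⟩
  have hDconv : ∀ j i, Tendsto (fun n => eLpNorm (fun q => D n j i q - g2i j i q) 3 μ) atTop (𝓝 0) := by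
    intro j i
    have h := tendsto_eLpNorm_stConv_sub_of_tendsto (fun n => hg2I n j i) (hg2iI j i) h13 h3t (hg2im j i).2
      (hg2conv j i) hφ hε hε0
    simp only [hρdef, hkndef] at h
    exact h
  ---------------------------------------------------------------- second derivatives: the fields `g3`
  have h2c : ∀ q : ℝ × UnitAddTorus d, |(fun _ : ℝ × UnitAddTorus d => (2 : ℝ)) q| ≤ 2 := fun q => by norm_num
  have h2cc : Continuous fun _ : ℝ × UnitAddTorus d => (2 : ℝ) := continuous_const
  set g3 : ℕ → d → d → ℝ × UnitAddTorus d → ℝ := fun n j i q =>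
    FunctionSpaces.Torus.partialDeriv i (FunctionSpaces.Torus.partialDeriv i (ψ q.1)) q.2 * ((w n j q.1) ⋆ K) q.2 +
      (fun _ : ℝ × UnitAddTorus d => (2 : ℝ)) q *
        (FunctionSpaces.Torus.partialDeriv i (ψ q.1) q.2 * ((w n j q.1) ⋆ FunctionSpaces.Torus.partialDeriv i K) q.2) +
      ψ q.1 q.2 * ((w n j q.1) ⋆ FunctionSpaces.Torus.partialDeriv i (FunctionSpaces.Torus.partialDeriv i K)) q.2 +
      ((fun z => ψ q.1 z * w n j q.1 z) ⋆
        FunctionSpaces.Torus.partialDeriv i (FunctionSpaces.Torus.partialDeriv i K)) q.2 with hg3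
  set g3i : d → d → ℝ × UnitAddTorus d → ℝ := fun j i q =>
    FunctionSpaces.Torus.partialDeriv i (FunctionSpaces.Torus.partialDeriv i (ψ q.1)) q.2 * sliceConv (Uc j) K q.1 q.2 +
      (fun _ : ℝ × UnitAddTorus d => (2 : ℝ)) q *
        (FunctionSpaces.Torus.partialDeriv i (ψ q.1) q.2 * sliceConv (Uc j) (FunctionSpaces.Torus.partialDeriv i K) q.1 q.2) +
      ψ q.1 q.2 * sliceConv (Uc j) (FunctionSpaces.Torus.partialDeriv i (FunctionSpaces.Torus.partialDeriv i K)) q.1 q.2 +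
      sliceConv (Ψ j) (FunctionSpaces.Torus.partialDeriv i (FunctionSpaces.Torus.partialDeriv i K)) q.1 q.2 with hg3i
  have hg3I : ∀ n j i, Integrable (g3 n j i) μ := fun n j i =>
    (((hIpiece (hcψiic i) (hcψii i) (hcψii0 i) n j hK).add
      ((hIpiece (hcψic i) (hcψi i) (hcψi0 i) n j (hKi i)).const_mul 2)).add
      (hIpiece hcψc hcψ hcψ0 n j (hKii i))).add (hIpieceΨ n j (hKii i))
  have hg3m : ∀ n j i, AEStronglyMeasurable (g3 n j i) μ := fun n j i => (hg3I n j i).1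
  have hg3iI : ∀ j i, Integrable (g3i j i) μ := fun j i =>
    (((hint_mul (hcψiic i) (hcψii i) (hint (hUm j) (hU1 j) hKc)).add
      ((hint_mul (hcψic i) (hcψi i) (hint (hUm j) (hU1 j) (hKi i).continuous)).const_mul 2)).add
      (hint_mul hcψc hcψ (hint (hUm j) (hU1 j) (hKii i).continuous))).add (hint (hΨm j) (hΨ1 j) (hKii i).continuous)
  have hg3im : ∀ j i, MemLp (g3i j i) 3 μ := fun j i =>
    (((hmem_mul (hcψiic i) (hcψii i) (hmem (hUm j) h13 h3t (hU3 j) hKc)).add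
      (hmem_mul h2cc h2c (hmem_mul (hcψic i) (hcψi i) (hmem (hUm j) h13 h3t (hU3 j) (hKi i).continuous)))).add
      (hmem_mul hcψc hcψ (hmem (hUm j) h13 h3t (hU3 j) (hKii i).continuous))).add
      (hmem (hΨm j) h13 h3t (hΨ3 j) (hKii i).continuous)
  -- measurability of the summands and of their limits
  have m3a : ∀ n j i, AEStronglyMeasurable (fun q : ℝ × UnitAddTorus d =>
      FunctionSpaces.Torus.partialDeriv i (FunctionSpaces.Torus.partialDeriv i (ψ q.1)) q.2 * ((w n j q.1) ⋆ K) q.2) μ :=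
    fun n j i => hMpiece (hcψiic i) n j hK
  have m3ai : ∀ j i, AEStronglyMeasurable (fun q : ℝ × UnitAddTorus d =>
      FunctionSpaces.Torus.partialDeriv i (FunctionSpaces.Torus.partialDeriv i (ψ q.1)) q.2 * sliceConv (Uc j) K q.1 q.2) μ :=
    fun j i => hMlim (hcψiic i) j hKc
  have m3b : ∀ n j i, AEStronglyMeasurable (fun q : ℝ × UnitAddTorus d => (fun _ : ℝ × UnitAddTorus d => (2 : ℝ)) q *
      (FunctionSpaces.Torus.partialDeriv i (ψ q.1) q.2 * ((w n j q.1) ⋆ FunctionSpaces.Torus.partialDeriv i K) q.2)) μ :=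
    fun n j i => aestronglyMeasurable_const.mul (hMpiece (hcψic i) n j (hKi i))
  have m3bi : ∀ j i, AEStronglyMeasurable (fun q : ℝ × UnitAddTorus d => (fun _ : ℝ × UnitAddTorus d => (2 : ℝ)) q *
      (FunctionSpaces.Torus.partialDeriv i (ψ q.1) q.2 * sliceConv (Uc j) (FunctionSpaces.Torus.partialDeriv i K) q.1 q.2)) μ :=
    fun j i => aestronglyMeasurable_const.mul (hMlim (hcψic i) j (hKi i).continuous)
  have m3c : ∀ n j i, AEStronglyMeasurable (fun q : ℝ × UnitAddTorus d =>
      ψ q.1 q.2 * ((w n j q.1) ⋆ FunctionSpaces.Torus.partialDeriv i (FunctionSpaces.Torus.partialDeriv i K)) q.2) μ :=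
    fun n j i => hMpiece hcψc n j (hKii i)
  have m3ci : ∀ j i, AEStronglyMeasurable (fun q : ℝ × UnitAddTorus d =>
      ψ q.1 q.2 * sliceConv (Uc j) (FunctionSpaces.Torus.partialDeriv i (FunctionSpaces.Torus.partialDeriv i K)) q.1 q.2) μ :=
    fun j i => hMlim hcψc j (hKii i).continuous
  have m3d : ∀ n j i, AEStronglyMeasurable (fun q : ℝ × UnitAddTorus d => ((fun z => ψ q.1 z * w n j q.1 z) ⋆
      FunctionSpaces.Torus.partialDeriv i (FunctionSpaces.Torus.partialDeriv i K)) q.2) μ :=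
    fun n j i => hMpieceΨ n j (hKii i)
  have m3di : ∀ j i, AEStronglyMeasurable (fun q : ℝ × UnitAddTorus d =>
      sliceConv (Ψ j) (FunctionSpaces.Torus.partialDeriv i (FunctionSpaces.Torus.partialDeriv i K)) q.1 q.2) μ :=
    fun j i => hMlimΨ j (hKii i).continuous
  have hg3conv : ∀ j i, Tendsto (fun n => eLpNorm (fun q => g3 n j i q - g3i j i q) 3 μ) atTop (𝓝 0) := by
    intro j i
    have hA := tendsto_eLpNorm_add_sub_add h13 (Eventually.of_forall fun n => (m3a n j i).sub (m3ai j i))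
      (Eventually.of_forall fun n => (m3b n j i).sub (m3bi j i))
      (hPconv (hcψii i) j hK) (tendsto_eLpNorm_mul_sub_mul h2c (hPconv (hcψi i) j (hKi i)))
    have hB := tendsto_eLpNorm_add_sub_add h13
      (Eventually.of_forall fun n => ((m3a n j i).add (m3b n j i)).sub ((m3ai j i).add (m3bi j i)))
      (Eventually.of_forall fun n => (m3c n j i).sub (m3ci j i)) hA (hPconv hcψ j (hKii i))
    have hC := tendsto_eLpNorm_add_sub_add h13
      (Eventually.of_forall fun n => (((m3a n j i).add (m3b n j i)).add (m3c n j i)).sub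
        (((m3ai j i).add (m3bi j i)).add (m3ci j i)))
      (Eventually.of_forall fun n => (m3d n j i).sub (m3di j i)) hB (hΨwconv j (hKii i))
    exact hC
  -- the second derivatives of the test components are `Sₙ g3`
  have hG'' : ∀ n j i, Integrable (fun q : ℝ × UnitAddTorus d =>
      FunctionSpaces.Torus.partialDeriv i (FunctionSpaces.Torus.partialDeriv i (fun z => G n j (q.1, z))) q.2) μ :=
    fun n j i => (hg3I n j i).congr (Eventually.of_forall fun q => (hddG n j i q).symm)
  have hdxx : ∀ n j i t x, FunctionSpaces.Torus.partialDeriv i (FunctionSpaces.Torus.partialDeriv i (φc n j t)) x =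
      FunctionSpaces.Torus.stConv (ρ n) (kn n) (g3 n j i) t x := by
    intro n j i t x
    have e : (fun q : ℝ × UnitAddTorus d =>
        FunctionSpaces.Torus.partialDeriv i (FunctionSpaces.Torus.partialDeriv i (fun z => G n j (q.1, z))) q.2) = g3 n j i :=
      funext (hddG n j i)
    rw [← e]
    exact partialDeriv_partialDeriv_stConv_slice (hGi n j) (hGs n j) i (hG' n j i) (hG'' n j i) (hρ1 n) (hρc n) (hks n) t x
  have hdL : ∀ n j t x, FunctionSpaces.Torus.laplacian (φc n j t) x =
      ∑ i, FunctionSpaces.Torus.stConv (ρ n) (kn n) (g3 n j i) t x := by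
    intro n j t x
    rw [FunctionSpaces.Torus.laplacian_eq_sum_partialDeriv_partialDeriv (hφsl n j t)]
    exact Finset.sum_congr rfl fun i _ => hdxx n j i t x
  set D3 : ℕ → d → d → ℝ × UnitAddTorus d → ℝ := fun n j i q =>
    FunctionSpaces.Torus.stConv (ρ n) (kn n) (g3 n j i) q.1 q.2 with hD3
  have hD3c : ∀ n j i, Continuous (D3 n j i) := fun n j i =>
    FunctionSpaces.Torus.continuous_uncurry_of_continuous_stLift
      (FunctionSpaces.Torus.contDiff_top_stLift_stConv (hg3I n j i) (hρs n) (hρc n) (hks n)).continuous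
  have hD3m : ∀ n j i, AEStronglyMeasurable (D3 n j i) μ := fun n j i => (hD3c n j i).aestronglyMeasurable
  have hD3b : ∀ n j i, ∃ C, ∀ q, |D3 n j i q| ≤ C := fun n j i => by
    obtain ⟨C, hC⟩ := exists_abs_stConv_le (hg3I n j i) (hρcont n) (hρc n) (hkc n)
    exact ⟨C, fun q => hC q.1 q.2⟩
  have hD3conv : ∀ j i, Tendsto (fun n => eLpNorm (fun q => D3 n j i q - g3i j i q) 3 μ) atTop (𝓝 0) := by
    intro j i
    have h := tendsto_eLpNorm_stConv_sub_of_tendsto (fun n => hg3I n j i) (hg3iI j i) h13 h3t (hg3im j i).2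
      (hg3conv j i) hφ hε hε0
    simp only [hρdef, hkndef] at h
    exact h
  ------------------------------------------------------------------ from `ℝ × T^d` to iterated integrals over `(0,T)`
  haveI := FunctionSpaces.holderTriple_threeHalves_three
  have hiter : ∀ {F : ℝ × UnitAddTorus d → ℝ} (_ : Integrable F μ) {G' : ℝ → UnitAddTorus d → ℝ}
      (_ : ∀ᵐ t ∂(volume : Measure ℝ), (t ∈ Ioo 0 T → ∫ y, F (t, y) = ∫ y, G' t y) ∧ (t ∉ Ioo 0 T → ∫ y, F (t, y) = 0)),
      ∫ q, F q ∂μ = ∫ t in Ioo 0 T, ∫ y, G' t y := by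
    intro F hF G' hsl
    rw [integral_prod _ hF, ← integral_indicator measurableSet_Ioo]
    refine integral_congr_ae ?_
    filter_upwards [hsl] with t ht
    by_cases hmem : t ∈ Ioo 0 T
    · rw [indicator_of_mem hmem, ht.1 hmem]
    · rw [indicator_of_notMem hmem, ht.2 hmem]
  -- a.e. slice data
  have hL3 : ∀ᵐ t ∂(volume.restrict (Ioo 0 T)), MemLp (u t) 3 volume := ae_memLp_three_of_lintegral hm hu3
  have hL1' : ∀ᵐ t ∂(volume : Measure ℝ), t ∈ Ioo 0 T → Integrable (u t) volume :=
    (ae_restrict_iff' measurableSet_Ioo).1 (hL3.mono fun t ht => ht.integrable (by norm_num))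
  have hgoodt : ∀ᵐ t ∂(volume : Measure ℝ), (∀ j, (fun y => Uc j (t, y)) =ᵐ[volume] fun y => stBar T u (t, y) j) ∧
      (t ∈ Ioo 0 T → Integrable (u t) volume) := (ae_slice_eq_of_ae_eq_stBar hUc).and hL1'
  have hin : ∀ {t : ℝ} (_ : t ∈ Ioo 0 T) (_ : ∀ j, (fun y => Uc j (t, y)) =ᵐ[volume] fun y => stBar T u (t, y) j)
      (k : UnitAddTorus d → ℝ) (j : d),
      sliceConv (Uc j) k t = (fun y => u t y j) ⋆ k ∧ sliceConv (Ψ j) k t = (fun y => ψ t y * u t y j) ⋆ k ∧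
        (∀ᵐ y ∂(volume : Measure (UnitAddTorus d)), Uc j (t, y) = u t y j) := by
    intro t ht hs k j
    have hslice : (fun y => Uc j (t, y)) =ᵐ[volume] fun y => u t y j := by
      filter_upwards [hs j] with y hy
      rw [hy, stBar_apply_of_mem ht]
    have hsliceΨ : (fun y => Ψ j (t, y)) =ᵐ[volume] fun y => ψ t y * u t y j := by
      filter_upwards [hslice] with y hy
      simp only [hΨdef, hy]
    exact ⟨FunctionSpaces.Torus.convolution_congr_ae_left (ContinuousLinearMap.lsmul ℝ ℝ) hslice k,
      FunctionSpaces.Torus.convolution_congr_ae_left (ContinuousLinearMap.lsmul ℝ ℝ) hsliceΨ k, hslice⟩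
  have hout : ∀ {t : ℝ} (_ : t ∉ Ioo 0 T) (_ : ∀ j, (fun y => Uc j (t, y)) =ᵐ[volume] fun y => stBar T u (t, y) j) (j : d),
      ∀ᵐ y ∂(volume : Measure (UnitAddTorus d)), Uc j (t, y) = 0 := by
    intro t ht hs j
    filter_upwards [hs j] with y hy
    rw [hy, stBar_apply_of_not_mem ht]
    rfl
  -- replacing `ū` by its representatives inside integrals over `ℝ × T^d`
  have hae : ∀ᵐ q ∂μ, ∀ j, Uc j q = stBar T u q j := ae_all_iff.2 fun j => hUc j
  ---------------------------------------------------------------- Term 2 (convective): reduction and limit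
  have hF2i : ∀ n j i, Integrable (fun q => stBar T u q j * stBar T u q i * D n j i q) μ := fun n j i => by
    obtain ⟨C, hC⟩ := hDb n j i
    exact ((hbarj2 j).integrable_mul (hbarj2 i)).mul_bdd (hDm n j i)
      (Eventually.of_forall fun q => by rw [Real.norm_eq_abs]; exact hC q)
  have hF2i' : ∀ n j i, Integrable (fun q => Uc j q * Uc i q * D n j i q) μ := fun n j i =>
    (hF2i n j i).congr (hae.mono fun q hq => by simp only [hq j, hq i])
  have hT2red : ∀ n, ∫ t in Ioo 0 T, ∫ x, ⟪u t x, FunctionSpaces.Torus.convect (u t)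
      (drTestApprox T u (ρ n) (kn n) K ψ t) x⟫_ℝ = ∑ j, ∑ i, ∫ q, Uc j q * Uc i q * D n j i q ∂μ := by
    intro n
    have hsum : ∑ j, ∑ i, ∫ q, Uc j q * Uc i q * D n j i q ∂μ = ∫ q, ∑ j, ∑ i, Uc j q * Uc i q * D n j i q ∂μ := by
      rw [integral_finsetSum _ fun j _ => integrable_finsetSum _ fun i _ => hF2i' n j i]
      refine Finset.sum_congr rfl fun j _ => ?_
      rw [integral_finsetSum _ fun i _ => hF2i' n j i]
    have hsum' : ∫ q, ∑ j, ∑ i, Uc j q * Uc i q * D n j i q ∂μ = ∫ q, ∑ j, ∑ i, stBar T u q j * stBar T u q i * D n j i q ∂μ := by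
      refine integral_congr_ae (hae.mono fun q hq => ?_)
      simp only [hq]
    rw [hsum, hsum', hΦvec n]
    symm
    refine hiter (integrable_finsetSum _ fun j _ => integrable_finsetSum _ fun i _ => hF2i n j i) (ae_of_all _ fun t => ?_)
    constructor
    · intro ht
      refine integral_congr_ae (ae_of_all _ fun y => ?_)
      show ∑ j, ∑ i, stBar T u (t, y) j * stBar T u (t, y) i * D n j i (t, y) =
        ⟪u t y, FunctionSpaces.Torus.convect (u t) (vecField (φc n) t) y⟫_ℝ
      rw [inner_convect_vecField (fun j => (hφsl n j t).isContDiff (by simp)) (u t) y]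
      refine Finset.sum_congr rfl fun j _ => ?_
      rw [Finset.mul_sum]
      refine Finset.sum_congr rfl fun i _ => ?_
      rw [stBar_apply_of_mem ht, hdx n j i t y]
      simp only [hD]
      ring
    · intro ht
      refine integral_eq_zero_of_ae (ae_of_all _ fun y => ?_)
      show ∑ j, ∑ i, stBar T u (t, y) j * stBar T u (t, y) i * D n j i (t, y) = 0
      exact Finset.sum_eq_zero fun j _ => Finset.sum_eq_zero fun i _ => by
        rw [stBar_apply_of_not_mem ht]; simp
  have hT2lim : Tendsto (fun n => ∑ j, ∑ i, ∫ q, Uc j q * Uc i q * D n j i q ∂μ) atTop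
      (𝓝 (∑ j, ∑ i, ∫ q, Uc j q * Uc i q * g2i j i q ∂μ)) := by
    refine tendsto_finsetSum _ fun j _ => tendsto_finsetSum _ fun i _ => ?_
    exact tendsto_integral_mul_of_tendsto_eLpNorm_three (f := fun q => Uc j q * Uc i q) (hU32 j i) (hDm · j i)
      (hg2im j i) (hDconv j i)
  ---------------------------------------------------------------- Term 4 (pressure): reduction and limit
  have hF4i : ∀ n, Integrable (fun q => stBarScalar T p q * ∑ i, D n i i q) μ := fun n => by
    have hsumb : ∃ C, ∀ q : ℝ × UnitAddTorus d, |∑ i, D n i i q| ≤ C := by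
      choose C hC using fun i => hDb n i i
      exact ⟨∑ i, C i, fun q => (Finset.abs_sum_le_sum_abs _ _).trans (Finset.sum_le_sum fun i _ => hC i q)⟩
    obtain ⟨C, hC⟩ := hsumb
    exact hpbar1.mul_bdd (Finset.aestronglyMeasurable_fun_sum _ fun i _ => hDm n i i)
      (Eventually.of_forall fun q => by rw [Real.norm_eq_abs]; exact hC q)
  have hT4red : ∀ n, ∫ t in Ioo 0 T, ∫ x, p t x * FunctionSpaces.Torus.divergence
      (drTestApprox T u (ρ n) (kn n) K ψ t) x = ∫ q, stBarScalar T p q * ∑ i, D n i i q ∂μ := by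
    intro n
    rw [hΦvec n]
    symm
    refine hiter (hF4i n) (ae_of_all _ fun t => ?_)
    constructor
    · intro ht
      refine integral_congr_ae (ae_of_all _ fun y => ?_)
      show stBarScalar T p (t, y) * ∑ i, D n i i (t, y) = p t y * FunctionSpaces.Torus.divergence (vecField (φc n) t) y
      rw [stBarScalar_apply_of_mem ht]
      congr 1
      show ∑ i, D n i i (t, y) = ∑ i, FunctionSpaces.Torus.partialDeriv i (fun z => vecField (φc n) t z i) y
      refine Finset.sum_congr rfl fun i _ => ?_
      rw [show (fun z => vecField (φc n) t z i) = φc n i t from funext fun z => vecField_apply _ _ _ _, hdx n i i t y]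
    · intro ht
      refine integral_eq_zero_of_ae (ae_of_all _ fun y => ?_)
      show stBarScalar T p (t, y) * ∑ i, D n i i (t, y) = 0
      rw [stBarScalar_apply_of_not_mem ht, zero_mul]
  have hT4lim : Tendsto (fun n => ∫ q, stBarScalar T p q * ∑ i, D n i i q ∂μ) atTop
      (𝓝 (∫ q, stBarScalar T p q * ∑ i, g2i i i q ∂μ)) :=
    tendsto_integral_mul_of_tendsto_eLpNorm_three hpbar32 (fun n => Finset.aestronglyMeasurable_fun_sum _ fun i _ => hDm n i i)
      (memLp_finsetSum Finset.univ fun i _ => hg2im i i)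
      (tendsto_eLpNorm_finset_sum_sub Finset.univ h13 (fun i _ => Eventually.of_forall fun n => (hDm n i i).sub (hg2im i i).1)
        fun i _ => hDconv i i)
  ---------------------------------------------------------------- Term 3 (viscous): reduction and limit
  have hF3i : ∀ n j, Integrable (fun q => stBar T u q j * ∑ i, D3 n j i q) μ := fun n j => by
    have hsumb : ∃ C, ∀ q : ℝ × UnitAddTorus d, |∑ i, D3 n j i q| ≤ C := by
      choose C hC using fun i => hD3b n j i
      exact ⟨∑ i, C i, fun q => (Finset.abs_sum_le_sum_abs _ _).trans (Finset.sum_le_sum fun i _ => hC i q)⟩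
    obtain ⟨C, hC⟩ := hsumb
    exact (hbarj1 j).mul_bdd (Finset.aestronglyMeasurable_fun_sum _ fun i _ => hD3m n j i)
      (Eventually.of_forall fun q => by rw [Real.norm_eq_abs]; exact hC q)
  have hF3i' : ∀ n j, Integrable (fun q => Uc j q * ∑ i, D3 n j i q) μ := fun n j =>
    (hF3i n j).congr (hae.mono fun q hq => by simp only [hq j])
  have hT3red : ∀ n, ∫ t in Ioo 0 T, ∫ x, ⟪u t x, FunctionSpaces.Torus.laplacian
      (drTestApprox T u (ρ n) (kn n) K ψ t) x⟫_ℝ = ∑ j, ∫ q, Uc j q * ∑ i, D3 n j i q ∂μ := by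
    intro n
    have hsum : ∑ j, ∫ q, Uc j q * ∑ i, D3 n j i q ∂μ = ∫ q, ∑ j, Uc j q * ∑ i, D3 n j i q ∂μ := by
      rw [integral_finsetSum _ fun j _ => hF3i' n j]
    have hsum' : ∫ q, ∑ j, Uc j q * ∑ i, D3 n j i q ∂μ = ∫ q, ∑ j, stBar T u q j * ∑ i, D3 n j i q ∂μ := by
      refine integral_congr_ae (hae.mono fun q hq => ?_)
      simp only [hq]
    rw [hsum, hsum', hΦvec n]
    symm
    refine hiter (integrable_finsetSum _ fun j _ => hF3i n j) (ae_of_all _ fun t => ?_)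
    constructor
    · intro ht
      refine integral_congr_ae (ae_of_all _ fun y => ?_)
      show ∑ j, stBar T u (t, y) j * ∑ i, D3 n j i (t, y) =
        ⟪u t y, FunctionSpaces.Torus.laplacian (vecField (φc n) t) y⟫_ℝ
      rw [inner_laplacian_vecField (fun j => hφsl n j t) (u t y) y]
      refine Finset.sum_congr rfl fun j _ => ?_
      rw [stBar_apply_of_mem ht, hdL n j t y]
    · intro ht
      refine integral_eq_zero_of_ae (ae_of_all _ fun y => ?_)
      show ∑ j, stBar T u (t, y) j * ∑ i, D3 n j i (t, y) = 0
      exact Finset.sum_eq_zero fun j _ => by rw [stBar_apply_of_not_mem ht]; simp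
  have hT3lim : Tendsto (fun n => ∑ j, ∫ q, Uc j q * ∑ i, D3 n j i q ∂μ) atTop
      (𝓝 (∑ j, ∫ q, Uc j q * ∑ i, g3i j i q ∂μ)) := by
    refine tendsto_finsetSum _ fun j _ => ?_
    exact tendsto_integral_mul_of_tendsto_eLpNorm_three (hU32' j) (fun n => Finset.aestronglyMeasurable_fun_sum _ fun i _ => hD3m n j i)
      (memLp_finsetSum Finset.univ fun i _ => hg3im j i)
      (tendsto_eLpNorm_finset_sum_sub Finset.univ h13 (fun i _ => Eventually.of_forall fun n => (hD3m n j i).sub (hg3im j i).1)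
        fun i _ => hD3conv j i)
  ---------------------------------------------------------------- Term 1 (time): reduction and limit
  have hw2 : ∀ n j, MemLp (fun q : ℝ × UnitAddTorus d => w n j q.1 q.2) 2 μ := by
    intro n j
    have h := eLpNorm_stConv_le (hU1 j) (φ n) (FunctionSpaces.Torus.continuous_kernel (hε n).1 (hε n).2)
      (fun y => FunctionSpaces.Torus.kernel_nonneg (hε n).1.le y) (FunctionSpaces.Torus.integral_kernel (hε n).1 (hε n).2) h12 h2t
    simp only [hρdef, hkndef] at h
    exact ⟨(hwc n j).aestronglyMeasurable, h.trans_lt (hU2 j).2⟩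
  have hv2 : ∀ n j, MemLp (fun q : ℝ × UnitAddTorus d => ((w n j q.1) ⋆ K) q.2) 2 μ := fun n j =>
    hmem (hwc n j).stronglyMeasurable h12 h2t (hw2 n j) hKc
  have hT1j : ∀ j, Tendsto (fun n => ∫ q, FunctionSpaces.Torus.timeDeriv ψ q.1 q.2 * w n j q.1 q.2 * ((w n j q.1) ⋆ K) q.2 ∂μ)
      atTop (𝓝 (∫ q, FunctionSpaces.Torus.timeDeriv ψ q.1 q.2 * Uc j q * sliceConv (Uc j) K q.1 q.2 ∂μ)) := fun j =>
    tendsto_integral_mul_mul_of_tendsto_eLpNorm_two hcψt hcψtc.aestronglyMeasurable (hw2 · j) (hv2 · j) (hU2 j)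
      (hmem (hUm j) h12 h2t (hU2 j) hKc) (hwconv j h12 h2t (hU2 j)) (hvconv j hK h12 h2t (hU2 j))
  have hI1i : ∀ n j, Integrable (fun q : ℝ × UnitAddTorus d =>
      FunctionSpaces.Torus.timeDeriv ψ q.1 q.2 * w n j q.1 q.2 * ((w n j q.1) ⋆ K) q.2) μ := by
    intro n j
    obtain ⟨hcont, M, hM⟩ := hwL n j hK
    refine integrable_of_bdd_of_time_support ((hcψtc.aestronglyMeasurable.mul (hwc n j).aestronglyMeasurable).mul
      hcont.aestronglyMeasurable) (M := Cψt * Cw n * M) (fun q => ?_) (a := a) (b := b) (fun q hq => ?_)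
    · rw [Real.norm_eq_abs, abs_mul, abs_mul]
      have h0 : 0 ≤ Cψt := (abs_nonneg _).trans (hcψt q)
      exact mul_le_mul (mul_le_mul (hcψt q) (hCw n j q.1 q.2) (abs_nonneg _) h0) (hM q.1 q.2) (abs_nonneg _)
        (mul_nonneg h0 ((abs_nonneg _).trans (hCw n j q.1 q.2)))
    · show FunctionSpaces.Torus.timeDeriv ψ q.1 q.2 * w n j q.1 q.2 * ((w n j q.1) ⋆ K) q.2 = 0
      rw [show FunctionSpaces.Torus.timeDeriv ψ q.1 q.2 = 0 from congrFun (hdt0 q.1 hq) q.2, zero_mul, zero_mul]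
  have hT1red : ∀ n, ∫ t in Ioo 0 T, ∫ x, ⟪drVelocityApprox T u (ρ n) (kn n) t x,
      vecConv (drVelocityApprox T u (ρ n) (kn n) t) K x⟫_ℝ * FunctionSpaces.Torus.timeDeriv ψ t x =
      ∑ j, ∫ q, FunctionSpaces.Torus.timeDeriv ψ q.1 q.2 * w n j q.1 q.2 * ((w n j q.1) ⋆ K) q.2 ∂μ := by
    intro n
    have hpt : ∀ t x, ⟪drVelocityApprox T u (ρ n) (kn n) t x, vecConv (drVelocityApprox T u (ρ n) (kn n) t) K x⟫_ℝ *
        FunctionSpaces.Torus.timeDeriv ψ t x =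
        ∑ j, FunctionSpaces.Torus.timeDeriv ψ t x * w n j t x * ((w n j t) ⋆ K) x := by
      intro t x
      rw [PiLp.inner_apply, Finset.sum_mul]
      refine Finset.sum_congr rfl fun j _ => ?_
      rw [vecConv_apply, hwvel]
      have e1 : (fun y => drVelocityApprox T u (ρ n) (kn n) t y j) = w n j t := funext fun y => hwvel n t y j
      rw [e1]
      simp only [RCLike.inner_apply, conj_trivial]
      ring
    simp_rw [hpt]
    rw [← integral_finsetSum _ fun j _ => hI1i n j, integral_prod _ (integrable_finsetSum _ fun j _ => hI1i n j)]
    -- the `t`-integrand vanishes off `(0, T)`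
    refine (setIntegral_eq_integral_of_forall_compl_eq_zero fun t ht => ?_).trans ?_
    · have ht' : t ∉ Icc a b := fun h => ht ⟨ha.trans_le h.1, h.2.trans_lt hbT⟩
      refine (integral_congr_ae (ae_of_all _ fun x => ?_)).trans (integral_zero _ _)
      show ∑ j, FunctionSpaces.Torus.timeDeriv ψ t x * w n j t x * ((w n j t) ⋆ K) x = 0
      refine Finset.sum_eq_zero fun j _ => ?_
      rw [show FunctionSpaces.Torus.timeDeriv ψ t x = 0 from congrFun (hdt0 t ht') x, zero_mul, zero_mul]
    · refine integral_congr_ae (ae_of_all _ fun t => integral_congr_ae (ae_of_all _ fun x => ?_))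
      rfl
  have hT1lim : Tendsto (fun n => ∑ j, ∫ q, FunctionSpaces.Torus.timeDeriv ψ q.1 q.2 * w n j q.1 q.2 * ((w n j q.1) ⋆ K) q.2 ∂μ)
      atTop (𝓝 (∑ j, ∫ q, FunctionSpaces.Torus.timeDeriv ψ q.1 q.2 * Uc j q * sliceConv (Uc j) K q.1 q.2 ∂μ)) :=
    tendsto_finsetSum _ fun j _ => hT1j j
  ------------------------------------------------------------------ identification of the limits
  have hI1 : ∑ j, ∫ q, FunctionSpaces.Torus.timeDeriv ψ q.1 q.2 * Uc j q * sliceConv (Uc j) K q.1 q.2 ∂μ =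
      ∫ t in Ioo 0 T, ∫ x, ⟪u t x, vecConv (u t) K x⟫_ℝ * FunctionSpaces.Torus.timeDeriv ψ t x := by
    have hFj : ∀ j, Integrable (fun q => FunctionSpaces.Torus.timeDeriv ψ q.1 q.2 * Uc j q * sliceConv (Uc j) K q.1 q.2) μ :=
      fun j => by
      have h := (hU32' j).integrable_mul (hmem_mul hcψtc hcψt (hmem (hUm j) h13 h3t (hU3 j) hKc))
      refine h.congr (Eventually.of_forall fun q => ?_)
      simp only [Pi.mul_apply]
      ring
    rw [← integral_finsetSum _ fun j _ => hFj j]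
    refine hiter (integrable_finsetSum _ fun j _ => hFj j) ?_
    filter_upwards [hgoodt] with t ht
    constructor
    · intro hmem'
      refine integral_congr_ae ?_
      have hall : ∀ᵐ y ∂(volume : Measure (UnitAddTorus d)), ∀ j, Uc j (t, y) = u t y j :=
        ae_all_iff.2 fun j => (hin hmem' ht.1 K j).2.2
      filter_upwards [hall] with y hy
      rw [PiLp.inner_apply, Finset.sum_mul]
      refine Finset.sum_congr rfl fun j _ => ?_
      simp only [hy j, (hin hmem' ht.1 K j).1, vecConv_apply]
      simp only [RCLike.inner_apply, conj_trivial]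
      ring
    · intro hmem'
      refine integral_eq_zero_of_ae ?_
      have hall : ∀ᵐ y ∂(volume : Measure (UnitAddTorus d)), ∀ j, Uc j (t, y) = 0 :=
        ae_all_iff.2 fun j => hout hmem' ht.1 j
      filter_upwards [hall] with y hy
      rw [Pi.zero_apply]
      exact Finset.sum_eq_zero fun j _ => by rw [hy j]; ring
  have hI2 : ∑ j, ∑ i, ∫ q, Uc j q * Uc i q * g2i j i q ∂μ =
      ∫ t in Ioo 0 T, ∫ x, ⟪u t x, FunctionSpaces.Torus.convect (u t) (symmTestField K (ψ t) (u t)) x⟫_ℝ := by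
    have hFji : ∀ j i, Integrable (fun q => Uc j q * Uc i q * g2i j i q) μ := fun j i =>
      (hU32 j i).integrable_mul (hg2im j i)
    have hsum : ∑ j, ∑ i, ∫ q, Uc j q * Uc i q * g2i j i q ∂μ = ∫ q, ∑ j, ∑ i, Uc j q * Uc i q * g2i j i q ∂μ := by
      rw [integral_finsetSum _ fun j _ => integrable_finsetSum _ fun i _ => hFji j i]
      refine Finset.sum_congr rfl fun j _ => ?_
      rw [integral_finsetSum _ fun i _ => hFji j i]
    rw [hsum]
    refine hiter (integrable_finsetSum _ fun j _ => integrable_finsetSum _ fun i _ => hFji j i) ?_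
    filter_upwards [hgoodt] with t ht
    constructor
    · intro hmem'
      have hut : Integrable (u t) volume := ht.2 hmem'
      have hΦ1 : FunctionSpaces.Torus.IsContDiff 1 (symmTestField K (ψ t) (u t)) :=
        (isSmooth_symmTestField hK (hψslice t) hut).isContDiff (by simp)
      refine integral_congr_ae ?_
      have hall : ∀ᵐ y ∂(volume : Measure (UnitAddTorus d)), ∀ j, Uc j (t, y) = u t y j :=
        ae_all_iff.2 fun j => (hin hmem' ht.1 K j).2.2
      filter_upwards [hall] with y hy
      rw [inner_convect_eq_sum hΦ1 (u t y) (u t) y]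
      refine Finset.sum_congr rfl fun j _ => ?_
      rw [Finset.mul_sum]
      refine Finset.sum_congr rfl fun i _ => ?_
      have e1 : ∀ k, sliceConv (Uc j) k t = (fun y => u t y j) ⋆ k := fun k => (hin hmem' ht.1 k j).1
      have e2 : ∀ k, sliceConv (Ψ j) k t = (fun y => ψ t y * u t y j) ⋆ k := fun k => (hin hmem' ht.1 k j).2.1
      rw [partialDeriv_symmTestField_kernel hK (hψslice t) hut i j y]
      simp only [hg2i, hy j, hy i, e1, e2]
      ring
    · intro hmem'
      refine integral_eq_zero_of_ae ?_
      have hall : ∀ᵐ y ∂(volume : Measure (UnitAddTorus d)), ∀ j, Uc j (t, y) = 0 :=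
        ae_all_iff.2 fun j => hout hmem' ht.1 j
      filter_upwards [hall] with y hy
      rw [Pi.zero_apply]
      exact Finset.sum_eq_zero fun j _ => Finset.sum_eq_zero fun i _ => by rw [hy j, zero_mul, zero_mul]
  have hI3 : ∑ j, ∫ q, Uc j q * ∑ i, g3i j i q ∂μ =
      ∫ t in Ioo 0 T, ∫ x, ⟪u t x, FunctionSpaces.Torus.laplacian (symmTestField K (ψ t) (u t)) x⟫_ℝ := by
    have hFj : ∀ j, Integrable (fun q => Uc j q * ∑ i, g3i j i q) μ := fun j =>
      (hU32' j).integrable_mul (memLp_finsetSum Finset.univ fun i _ => hg3im j i)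
    rw [← integral_finsetSum _ fun j _ => hFj j]
    refine hiter (integrable_finsetSum _ fun j _ => hFj j) ?_
    filter_upwards [hgoodt] with t ht
    constructor
    · intro hmem'
      have hut : Integrable (u t) volume := ht.2 hmem'
      refine integral_congr_ae ?_
      have hall : ∀ᵐ y ∂(volume : Measure (UnitAddTorus d)), ∀ j, Uc j (t, y) = u t y j :=
        ae_all_iff.2 fun j => (hin hmem' ht.1 K j).2.2
      filter_upwards [hall] with y hy
      rw [inner_laplacian_symmTestField_eq_sum hK (hψslice t) hut (u t y) y]
      refine Finset.sum_congr rfl fun j _ => ?_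
      have hs : FunctionSpaces.Torus.IsSmooth (fun y => symmTestField K (ψ t) (u t) y j) :=
        (EuclideanSpace.proj (𝕜 := ℝ) j).contDiff.comp (isSmooth_symmTestField hK (hψslice t) hut)
      have e1 : ∀ k, sliceConv (Uc j) k t = (fun y => u t y j) ⋆ k := fun k => (hin hmem' ht.1 k j).1
      have e2 : ∀ k, sliceConv (Ψ j) k t = (fun y => ψ t y * u t y j) ⋆ k := fun k => (hin hmem' ht.1 k j).2.1
      rw [FunctionSpaces.Torus.laplacian_eq_sum_partialDeriv_partialDeriv hs y, hy j]
      congr 1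
      refine Finset.sum_congr rfl fun i _ => ?_
      rw [partialDeriv_partialDeriv_symmTestField hK (hψslice t) hut i j y]
      simp only [hg3i, e1, e2]
    · intro hmem'
      refine integral_eq_zero_of_ae ?_
      have hall : ∀ᵐ y ∂(volume : Measure (UnitAddTorus d)), ∀ j, Uc j (t, y) = 0 :=
        ae_all_iff.2 fun j => hout hmem' ht.1 j
      filter_upwards [hall] with y hy
      rw [Pi.zero_apply]
      exact Finset.sum_eq_zero fun j _ => by rw [hy j, zero_mul]
  have hI4 : ∫ q, stBarScalar T p q * ∑ i, g2i i i q ∂μ =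
      ∫ t in Ioo 0 T, ∫ x, p t x * FunctionSpaces.Torus.divergence (symmTestField K (ψ t) (u t)) x := by
    have hF : Integrable (fun q => stBarScalar T p q * ∑ i, g2i i i q) μ :=
      hpbar32.integrable_mul (memLp_finsetSum Finset.univ fun i _ => hg2im i i)
    refine hiter hF ?_
    filter_upwards [hgoodt] with t ht
    constructor
    · intro hmem'
      have hut : Integrable (u t) volume := ht.2 hmem'
      refine integral_congr_ae ?_
      have hall : ∀ᵐ y ∂(volume : Measure (UnitAddTorus d)), ∀ j, Uc j (t, y) = u t y j :=
        ae_all_iff.2 fun j => (hin hmem' ht.1 K j).2.2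
      filter_upwards [hall] with y hy
      rw [stBarScalar_apply_of_mem hmem', divergence_symmTestField_eq_sum hK (hψslice t) hut y]
      congr 1
      refine Finset.sum_congr rfl fun i _ => ?_
      have e1 : ∀ k, sliceConv (Uc i) k t = (fun y => u t y i) ⋆ k := fun k => (hin hmem' ht.1 k i).1
      have e2 : ∀ k, sliceConv (Ψ i) k t = (fun y => ψ t y * u t y i) ⋆ k := fun k => (hin hmem' ht.1 k i).2.1
      simp only [hg2i, e1, e2]
    · intro hmem'
      refine integral_eq_zero_of_ae (Eventually.of_forall fun y => ?_)
      show stBarScalar T p (t, y) * ∑ i, g2i i i (t, y) = 0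
      rw [stBarScalar_apply_of_not_mem hmem', zero_mul]
  ------------------------------------------------------------------ conclusion
  refine ⟨?_, ?_, ?_, ?_⟩
  · have h := hT1lim
    rw [hI1] at h
    exact h.congr fun n => (hT1red n).symm
  · have h := hT2lim
    rw [hI2] at h
    exact h.congr fun n => (hT2red n).symm
  · have h := hT3lim
    rw [hI3] at h
    exact h.congr fun n => (hT3red n).symm
  · have h := hT4lim
    rw [hI4] at h
    exact h.congr fun n => (hT4red n).symm

end Discharge

end Literature.Analysis.FluidPDE.Torus
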